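import Literature.Computability.Learning.QueryP
import Literature.Computability.Learning.LearnerRun
import Literature.Computability.Complexity.LengthCompare
import Literature.Computability.Complexity.OracleProofs
import Literature.Computability.Learning.LearnerAnalysis
import Literature.Computability.Learning.AmpPCircuit
import Literature.Computability.Learning.NaturalLearning
import HarnessLib

/-!
# The `AC⁰[p]` learner: coins, selection, machines and the success analysis

Groundwork and analysis for the named fact `Literature.Computability.Learning.cikk_learn_AC0Mod`
(CIKK 2016, Cor. 5.4), in five parts (each with its own header below):

1. **extended coin tuples** (`ExtCoinsP`, the segment writer `extList`, `card_ExtCoinsP_ge`);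
2. **candidates, validation and selection** (`candN`, `passesN`, `gOutN`, the output function `gPFn ∈ FP`);
3. **the machines** (`cikkLearnerP`, `cikkEvalP`, polynomial time, the PAC run `runIdx_cikkLearnerP`);
4. **the counting analysis** (`predN_extList`, `successP_of`, `card_goodWP_ge`, `card_badVP_le`, `card_not_successP_le`);
5. **good levels** (`GoodLevelP`, `hadv_of_goodLevelP`, `LvlHyps`, `card_typedGood_ge`).

## References

* M. Carmosino, R. Impagliazzo, V. Kabanets, A. Kolokolova, *Learning algorithms from natural
  proofs*, CCC 2016, §5, Thm. 5.1, Cor. 5.4 [CarmosinoImpagliazzoKabanetsKolokolova2016].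
* W. Hoeffding, *Probability inequalities for sums of bounded random variables*, JASA 58 (1963), Thm. 1 [Hoeffding1963].
-/

/-!
## Part — The `AC⁰[p]` learner: valid coin segments and the extended run coins

Analysis groundwork for the named fact `Literature.Computability.Learning.cikk_learn_AC0Mod`
(CIKK 2016, Cor. 5.4). A run of the learner reads its typed coins `ω : RunCoinsP` off a coin
segment (`HypPFP.coinsToRunP`), discarding from every valid `β`-block either the junk or the
field part where the run does not need it. This file makes the fibres of that map explicit:

* `ExtraP`, `ExtCoinsP = RunCoinsP × ExtraP` (the discarded parts) and `coinsToExtP` (reading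
  both);
* `extList e` — **the layout writer**: the coin segment of an extended coin tuple (the field
  encodings concatenated in the layout of `HypPFP`), `length_extList`;
* **`coinsToExtP (extList e) = e`** (`coinsToExtP_extList`, in particular
  `coinsToRunP (extList e) = e.1`) and **`ValidSeg (extList e)`** (`validSeg_extList`); hence
  `extList` is injective (`extList_injective`);
* the cardinality of the extended coins (`card_ExtCoinsP_ge`): at least `(1 - p·N_b/2^β) · 2^{runLen}`
  for `N_b` the number of `β`-blocks.

So a set of good typed coins of density `p₀` yields at least `p₀ (1 - pN_b/2^β) 2^{runLen}` coin
segments whose run is good (the analysis, `AnalysisP`).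

## References

* M. Carmosino, R. Impagliazzo, V. Kabanets, A. Kolokolova, *Learning algorithms from natural
  proofs*, CCC 2016, §5 (the learner's randomness) [CarmosinoImpagliazzoKabanetsKolokolova2016].
-/

namespace Literature.Computability.Learning

namespace Modp

open Literature.Computability.Complexity Literature.Computability.Complexity.GaussRank
  Literature.Computability.Cryptography Literature.Computability.MetaComplexity _root_.Computability Finset

variable [P : PrimeP]

/-! ### Generic slicing of concatenations -/

section Slices

omit P

/-- A slice inside the left part. [folklore] -/
theorem sl_append_left (A B : List Bool) {o len : ℕ} (h : o + len ≤ A.length) : sl (A ++ B) o len = sl A o len := by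
  rw [sl_eq_ofFn _ (by rw [List.length_append]; omega), sl_eq_ofFn _ h]
  refine congrArg List.ofFn (funext fun i => ?_)
  rw [rdBits, rdBits, List.getD_eq_getElem?_getD, List.getElem?_append_left (by omega), ← List.getD_eq_getElem?_getD]

/-- A slice inside the right part. [folklore] -/
theorem sl_append_right (A B : List Bool) (o len : ℕ) : sl (A ++ B) (A.length + o) len = sl B o len := by
  rw [sl, sl, ← List.drop_drop, List.drop_left]

/-- A slice at the start of the right part. [folklore] -/
theorem sl_append_right' (A B : List Bool) (len : ℕ) : sl (A ++ B) A.length len = sl B 0 len := by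
  rw [← sl_append_right A B 0 len, Nat.add_zero]

/-- The full slice of a list is the list. [folklore] -/
theorem sl_zero_length (A : List Bool) : sl A 0 A.length = A := by
  rw [sl, List.drop_zero, List.takeD_eq_take _ le_rfl, List.take_length]

/-- The full slice of the left part. [folklore] -/
theorem sl_append_zero (A B : List Bool) : sl (A ++ B) 0 A.length = A := by
  rw [sl_append_left A B (by omega), sl_zero_length]

/-- The full slice of the left part, with its length named. [folklore] -/
theorem sl_append_zero' (A B : List Bool) {m : ℕ} (h : A.length = m) : sl (A ++ B) 0 m = A := by
  rw [← h]; exact sl_append_zero A B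

/-- A slice of a slice. [folklore] -/
theorem sl_sl (u : List Bool) (O L : ℕ) {o len : ℕ} (h : o + len ≤ L) : sl (sl u O L) o len = sl u (O + o) len := by
  apply List.ext_getElem
  · simp only [sl, List.takeD_length]
  · intro j h1 h2
    simp only [sl, List.takeD_length] at h1
    rw [← List.getD_eq_getElem _ false, ← List.getD_eq_getElem _ false, getD_sl _ _ h1, getD_sl _ _ (by omega), getD_sl _ _ h1, Nat.add_assoc]

/-- A slice inside piece `j` of a concatenation of pieces of a common length. [folklore] -/
theorem sl_flatten_ofFn {m c : ℕ} (F : Fin m → List Bool) (hF : ∀ j, (F j).length = c) (j : Fin m) {o len : ℕ} (h : o + len ≤ c) :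
    sl (List.ofFn F).flatten (j * c + o) len = sl (F j) o len := by
  induction m with
  | zero => exact j.elim0
  | succ m ih =>
    rw [List.ofFn_succ, List.flatten_cons]
    rcases Fin.eq_zero_or_eq_succ j with rfl | ⟨j', rfl⟩
    · rw [Fin.val_zero, zero_mul, zero_add, sl_append_left _ _ (by rw [hF]; exact h)]
    · rw [Fin.val_succ, Nat.succ_mul, show (j' : ℕ) * c + c + o = (F 0).length + ((j' : ℕ) * c + o) by rw [hF]; ring, sl_append_right,
        ih (fun i => F i.succ) (fun i => hF i.succ) j']

end Slices

/-! ### Block encodings -/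

section Blocks

variable {β : ℕ}

/-- The `β` bits of a valid block with junk `q` and field `r`: the bits of `r + p q`. [folklore] -/
def blkBits (q : Fin (jB 𝔭 β)) (r : ZMod 𝔭) : List Bool := List.ofFn (encPos q r)

/-- A block has `β` bits. [folklore] -/
@[simp] theorem length_blkBits (q : Fin (jB 𝔭 β)) (r : ZMod 𝔭) : (blkBits q r).length = β := List.length_ofFn

/-- The whole slice of a block. [folklore] -/
theorem sl_zero_blkBits (q : Fin (jB 𝔭 β)) (r : ZMod 𝔭) : sl (blkBits q r) 0 β = blkBits q r := by
  have h := sl_zero_length (blkBits q r); rwa [length_blkBits] at h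

omit P in
/-- The `w` low bits of `v`. [folklore] -/
def lowBitsL (w v : ℕ) : List Bool := List.ofFn fun e : Fin w => v.testBit e

omit P in
/-- `lowBitsL` has `w` bits. [folklore] -/
@[simp] theorem length_lowBitsL (w v : ℕ) : (lowBitsL w v).length = w := List.length_ofFn

omit P in
/-- The value of the low bits of `v < 2^w` is `v`. [folklore] -/
theorem bitsToNat_lowBitsL {w v : ℕ} (hv : v < 2 ^ w) : bitsToNat (lowBitsL w v) = v := by
  apply Nat.eq_of_testBit_eq
  intro e
  rw [Com.testBit_bitsToNat, lowBitsL]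
  by_cases he : e < w
  · rw [List.getD_eq_getElem _ _ (by simpa using he), List.getElem_ofFn]
  · rw [List.getD_eq_default _ _ (by simp; omega)]
    symm
    apply Nat.testBit_eq_false_of_lt
    exact lt_of_lt_of_le hv (Nat.pow_le_pow_right (by norm_num) (not_lt.1 he))

/-- The bits of a block are the low bits of its value. [folklore] -/
theorem blkBits_eq_lowBitsL (q : Fin (jB 𝔭 β)) (r : ZMod 𝔭) : blkBits q r = lowBitsL β (encPosN q r) := by
  rw [blkBits, lowBitsL]
  exact congrArg List.ofFn (funext fun e => encPos_apply q r e)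

/-- The value of a block. [folklore] -/
theorem bitsToNat_blkBits (q : Fin (jB 𝔭 β)) (r : ZMod 𝔭) : bitsToNat (blkBits q r) = encPosN q r := by
  rw [blkBits_eq_lowBitsL, bitsToNat_lowBitsL (encPosN_lt q r)]

/-- The value of a block is below `p · B`. [folklore] -/
theorem encPosN_lt_mul (q : Fin (jB 𝔭 β)) (r : ZMod 𝔭) : encPosN q r < 𝔭 * jB 𝔭 β := by
  rw [encPosN]
  have hr := r.val_lt
  have hq : (q : ℕ) + 1 ≤ jB 𝔭 β := q.isLt
  calc r.val + 𝔭 * q < 𝔭 + 𝔭 * q := by omega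
    _ = 𝔭 * (q + 1) := by ring
    _ ≤ 𝔭 * jB 𝔭 β := Nat.mul_le_mul_left _ hq

/-- The junk of a block value. [folklore] -/
theorem encPosN_div (q : Fin (jB 𝔭 β)) (r : ZMod 𝔭) : encPosN q r / 𝔭 = q := by
  rw [encPosN, Nat.add_mul_div_left _ _ P.prime.pos, Nat.div_eq_of_lt r.val_lt, zero_add]

/-- The field of a block value. [folklore] -/
theorem encPosN_cast (q : Fin (jB 𝔭 β)) (r : ZMod 𝔭) : ((encPosN q r : ℕ) : ZMod 𝔭) = r := by
  rw [encPosN, Nat.cast_add, Nat.cast_mul, ZMod.natCast_self, zero_mul, add_zero, ZMod.natCast_zmod_val]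

/-- **Reading a block**: if the slice of `S` at `o` is a block, its value, validity, field and junk. [folklore] -/
theorem read_block (hB : 0 < jB 𝔭 β) {S : List Bool} {o : ℕ} {q : Fin (jB 𝔭 β)} {r : ZMod 𝔭} (h : sl S o β = blkBits q r) :
    slv S o β = encPosN q r ∧ BlockValid β S o ∧ fieldZ β S o = r ∧ junkFin hB S o = q := by
  have hv : slv S o β = encPosN q r := by rw [slv, h, bitsToNat_blkBits]
  refine ⟨hv, ?_, ?_, ?_⟩
  · rw [BlockValid, hv]; exact encPosN_lt_mul q r
  · rw [fieldZ, hv, encPosN_cast]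
  · apply Fin.ext
    rw [junkFin_val hB S (by rw [BlockValid, hv]; exact encPosN_lt_mul q r), hv, encPosN_div]

end Blocks

/-! ### Reading blocks and points -/

section ReadBlocks

omit P in
/-- Reading the whole string of a function. [folklore] -/
theorem rdBits_ofFn {m : ℕ} (g : Fin m → Bool) : rdBits (List.ofFn g) 0 m = g := by
  funext i; rw [rdBits, zero_add, List.getD_eq_getElem _ _ (by simp), List.getElem_ofFn]

omit P in
/-- Reading a string of the right length from its start. [folklore] -/
theorem rdBits_of_sl_eq {S : List Bool} {o m : ℕ} {g : Fin m → Bool} (h : sl S o m = List.ofFn g) : rdBits S o m = g := by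
  rw [← rdBits_sl, h, rdBits_ofFn]

variable {n k β : ℕ}

/-- **The point `i` of a block string.** [folklore] -/
theorem sl_blockBits_point (σ : SBlk n k 𝔭 β) (i : Fin k) : sl (blockBits (encBlk σ)) (i * n) n = List.ofFn (σ.1 i).1 := by
  have hin : (i : ℕ) * n + n ≤ k * n + k * β := by
    have := Nat.mul_le_mul_right n (i.isLt : (i : ℕ) + 1 ≤ k); rw [Nat.succ_mul] at this; omega
  rw [sl_eq_ofFn _ (by rw [length_blockBits]; exact hin)]
  refine congrArg List.ofFn (funext fun j => ?_)
  rw [rdBits, blockBits, List.getD_eq_getElem _ _ (by rw [List.length_ofFn]; have := j.isLt; omega), List.getElem_ofFn]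
  have : (innerEquiv n k β).symm ⟨(i : ℕ) * n + j, by have := j.isLt; omega⟩ = Sum.inl (i, j) :=
    (Equiv.symm_apply_eq _).2 (Fin.ext (by rw [innerEquiv_inl_val]))
  simp only [this, blkBit, encBlk]

/-- **The position block `i` of a block string.** [folklore] -/
theorem sl_blockBits_pos (σ : SBlk n k 𝔭 β) (i : Fin k) : sl (blockBits (encBlk σ)) (k * n + i * β) β = blkBits (σ.1 i).2 (σ.2 i) := by
  have hin : k * n + (i : ℕ) * β + β ≤ k * n + k * β := by
    have := Nat.mul_le_mul_right β (i.isLt : (i : ℕ) + 1 ≤ k); rw [Nat.succ_mul] at this; omega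
  rw [sl_eq_ofFn _ (by rw [length_blockBits]; exact hin), blkBits]
  refine congrArg List.ofFn (funext fun e => ?_)
  rw [rdBits, blockBits, List.getD_eq_getElem _ _ (by rw [List.length_ofFn]; have := e.isLt; omega), List.getElem_ofFn]
  have : (innerEquiv n k β).symm ⟨k * n + (i : ℕ) * β + e, by have := e.isLt; omega⟩ = Sum.inr (i, e) :=
    (Equiv.symm_apply_eq _).2 (Fin.ext (by rw [innerEquiv_inr_val]; ring))
  simp only [this, blkBit, encBlk]

end ReadBlocks

/-! ### The extended coins and the layout writer -/

section Ext

variable (te ℓ n κ β τ kk t : ℕ)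

/-- **The discarded parts**: the junk of the field-only blocks (labels, `u, u'`, seeds, guesses) and
the field of the junk-only blocks (DP tuple, steps, `q₀`). [folklore] -/
abbrev ExtraP : Type :=
  ((Fin (2 ^ τ * 2) → Fin (jB 𝔭 β)) × (Fin (jB 𝔭 β) × Fin (jB 𝔭 β)) × (Fin kk → Fin (2 ^ κ) → Fin (jB 𝔭 β)) × (Fin kk → Fin (jB 𝔭 β))) ×
    ((Fin (2 ^ κ) → ZMod 𝔭) × (Fin t → Fin (2 ^ κ) → ZMod 𝔭) × ZMod 𝔭)

/-- **The extended run coins.** [folklore] -/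
abbrev ExtCoinsP : Type := RunCoinsP n 𝔭 β (2 ^ κ) (2 ^ τ) (2 ^ ℓ) (𝔭 ^ te * 𝔭 ^ te) kk t × ExtraP κ β τ kk t

variable (hB : 0 < jB 𝔭 β)

/-- **Reading the extended coins off a segment.** [folklore] -/
noncomputable def coinsToExtP (seg : List Bool) : ExtCoinsP te ℓ n κ β τ kk t :=
  let k := 2 ^ κ
  let T := 2 ^ τ
  let Q := 𝔭 ^ te
  let oS := offSteps n k β T ℓ Q (2 ^ ℓ) kk τ
  let sL := stepLenP n k β κ
  (coinsToRunP te ℓ n κ β τ kk t hB seg,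
   ((fun c => junkFin hB seg (offLab n k β T ℓ Q (2 ^ ℓ) τ + c * β),
     (junkFin hB seg (offU n k β T ℓ Q (2 ^ ℓ) τ), junkFin hB seg (offU n k β T ℓ Q (2 ^ ℓ) τ + β)),
     fun tt j => junkFin hB seg (offSeeds n k β T ℓ Q (2 ^ ℓ) τ + (tt * k + j) * β),
     fun tt => junkFin hB seg (offGuess n k β T ℓ Q (2 ^ ℓ) kk τ + tt * β)),
    (fun i => fieldZ β seg (offTup n k β T ℓ Q (2 ^ ℓ) kk τ + i * (n + β) + n),
     fun r i => fieldZ β seg (oS + r * sL + κ + i * (n + β) + n),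
     fieldZ β seg (offJunk n k β T ℓ Q (2 ^ ℓ) kk t κ τ))))

variable {te ℓ n κ β τ kk t}

section Fields

variable (e : ExtCoinsP te ℓ n κ β τ kk t)

omit P in
/-- Flattening pieces of a fixed length. [folklore] -/
theorem length_flatten_ofFn {m c : ℕ} (F : Fin m → List Bool) (hF : ∀ j, (F j).length = c) : (List.ofFn F).flatten.length = m * c := by
  induction m with
  | zero => simp
  | succ m ih => rw [List.ofFn_succ, List.flatten_cons, List.length_append, hF, ih (fun j => F j.succ) (fun j => hF j.succ)]; ring

/-- The field of the block index `i`. [folklore] -/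
noncomputable def fI : List Bool := List.ofFn ((boolFunEquivFin ℓ).symm e.1.1.1.1.1.1)

/-- The field of the seed `z`. [folklore] -/
noncomputable def fZ : List Bool := List.ofFn e.1.1.1.1.1.2.1

/-- The field of the advice `w`. [folklore] -/
noncomputable def fW : List Bool := List.ofFn e.1.1.1.1.1.2.2

/-- The field of the hybrid index `m`. [folklore] -/
noncomputable def fM : List Bool := lowBitsL (τ + 1) (e.1.1.1.1.2.1 : ℕ)

/-- The field of the vN fillers. [folklore] -/
noncomputable def fF : List Bool := inputBits e.1.1.1.1.2.2.1

/-- The field of the ideal labels. [folklore] -/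
noncomputable def fL : List Bool := (List.ofFn fun c => blkBits (e.2.1.1 c) (e.1.1.1.1.2.2.2.1 c)).flatten

/-- The field of `u`. [folklore] -/
noncomputable def fU : List Bool := blkBits e.2.1.2.1.1 e.1.1.1.1.2.2.2.2.1

/-- The field of `u'`. [folklore] -/
noncomputable def fU' : List Bool := blkBits e.2.1.2.1.2 e.1.1.1.1.2.2.2.2.2

/-- The field of the GL seeds. [folklore] -/
noncomputable def fS : List Bool := (List.ofFn fun tt => (List.ofFn fun j => blkBits (e.2.1.2.2.1 tt j) (e.1.1.1.2.1 tt j)).flatten).flatten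

/-- The field of the GL guesses. [folklore] -/
noncomputable def fG : List Bool := (List.ofFn fun tt => blkBits (e.2.1.2.2.2 tt) (e.1.1.1.2.2 tt)).flatten

/-- The field of the trusted positions `Pb`. [folklore] -/
noncomputable def fP : List Bool := List.ofFn e.1.1.2.1

/-- The field of the DP tuple. [folklore] -/
noncomputable def fA : List Bool := (List.ofFn fun i => List.ofFn (e.1.1.2.2.1 i).1 ++ blkBits (e.1.1.2.2.1 i).2 (e.2.2.1 i)).flatten

/-- The field of the DP steps. [folklore] -/
noncomputable def fT : List Bool := (List.ofFn fun r => lowBitsL κ ((e.1.1.2.2.2 r).1 : ℕ) ++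
    (List.ofFn fun i => List.ofFn ((e.1.1.2.2.2 r).2 i).1 ++ blkBits ((e.1.1.2.2.2 r).2 i).2 (e.2.2.2.1 r i)).flatten).flatten

/-- The field of the junk coin `q₀`. [folklore] -/
noncomputable def fQ : List Bool := blkBits e.1.2 e.2.2.2.2

/-- The length of the field of the block index `i`. [folklore] -/
@[simp] theorem length_fI : (fI e).length = ℓ := List.length_ofFn

/-- The length of the field of the seed `z`. [folklore] -/
@[simp] theorem length_fZ : (fZ e).length = 𝔭 ^ te * 𝔭 ^ te := List.length_ofFn

/-- The length of the field of the advice `w`. [folklore] -/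
@[simp] theorem length_fW : (fW e).length = 2 ^ ℓ := List.length_ofFn

/-- The length of the field of the hybrid index `m`. [folklore] -/
@[simp] theorem length_fM : (fM e).length = τ + 1 := length_lowBitsL _ _

/-- The length of the field of the vN fillers. [folklore] -/
@[simp] theorem length_fF : (fF e).length = 2 ^ τ * 2 * (2 ^ κ * n + 2 ^ κ * β) := length_inputBits _

/-- The length of the field of the ideal labels. [folklore] -/
@[simp] theorem length_fL : (fL e).length = 2 ^ τ * 2 * β := length_flatten_ofFn _ fun _ => length_blkBits _ _

/-- The length of the field of `u`. [folklore] -/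
@[simp] theorem length_fU : (fU e).length = β := length_blkBits _ _

/-- The length of the field of `u'`. [folklore] -/
@[simp] theorem length_fUp : (fU' e).length = β := length_blkBits _ _

/-- The length of the field of the GL seeds. [folklore] -/
@[simp] theorem length_fS : (fS e).length = kk * (2 ^ κ * β) := length_flatten_ofFn _ fun _ => length_flatten_ofFn _ fun _ => length_blkBits _ _

/-- The length of the field of the GL guesses. [folklore] -/
@[simp] theorem length_fG : (fG e).length = kk * β := length_flatten_ofFn _ fun _ => length_blkBits _ _

/-- The length of the field of the trusted positions `Pb`. [folklore] -/
@[simp] theorem length_fP : (fP e).length = 2 ^ κ := List.length_ofFn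

/-- The length of the field of the DP tuple. [folklore] -/
@[simp] theorem length_fA : (fA e).length = 2 ^ κ * (n + β) := length_flatten_ofFn _ fun _ => by rw [List.length_append, List.length_ofFn, length_blkBits]

/-- The length of the field of the DP steps. [folklore] -/
@[simp] theorem length_fT : (fT e).length = t * (κ + 2 ^ κ * (n + β)) := length_flatten_ofFn _ fun _ => by
    rw [List.length_append, length_lowBitsL, length_flatten_ofFn _ fun _ => by rw [List.length_append, List.length_ofFn, length_blkBits]]

/-- The length of the field of the junk coin `q₀`. [folklore] -/
@[simp] theorem length_fQ : (fQ e).length = β := length_blkBits _ _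

/-- **The layout writer**: the coin segment of an extended coin tuple. [folklore] -/
noncomputable def extList : List Bool :=
  fI e ++ (fZ e ++ (fW e ++ (fM e ++ (fF e ++ (fL e ++ (fU e ++ (fU' e ++ (fS e ++ (fG e ++ (fP e ++ (fA e ++ (fT e ++ (fQ e)))))))))))))

/-- **The segment has the run length.** [folklore] -/
theorem length_extList : (extList e).length = runLenP n (2 ^ κ) β (2 ^ τ) ℓ (𝔭 ^ te) (2 ^ ℓ) kk t κ τ := by
  simp only [extList, List.length_append, length_fI, length_fZ, length_fW, length_fM, length_fF, length_fL, length_fU, length_fUp, length_fS,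
    length_fG, length_fP, length_fA, length_fT, length_fQ]
  unfold runLenP offJunk offSteps offTup offPbP offGuess offSeeds offU offLab offFil offM offWP offZ stepLenP
  ring

end Fields

end Ext


/-! ### Reading the fields back -/

section Read

variable {te ℓ n κ β τ kk t : ℕ} (e : ExtCoinsP te ℓ n κ β τ kk t)

local notation "S" => extList e

/-- **Reading the field `fI`.** [folklore] -/
theorem sl_fI : sl S (0) (ℓ) = fI e := by
  rw [extList]
  exact sl_append_zero' _ _ (length_fI e)

/-- **Reading the field `fZ`.** [folklore] -/
theorem sl_fZ : sl S (offZ ℓ) (𝔭 ^ te * 𝔭 ^ te) = fZ e := by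
  have hoff : offZ ℓ = (fI e).length := by
    simp only [length_fI, offZ]
    try ring
  rw [hoff, extList, sl_append_right']
  exact sl_append_zero' _ _ (length_fZ e)

/-- **Reading the field `fW`.** [folklore] -/
theorem sl_fW : sl S (offWP ℓ (𝔭 ^ te)) (2 ^ ℓ) = fW e := by
  have hoff : offWP ℓ (𝔭 ^ te) = (fI e).length + ((fZ e).length) := by
    simp only [length_fI, length_fZ, offWP, offZ]
    try ring
  rw [hoff, extList, sl_append_right, sl_append_right']
  exact sl_append_zero' _ _ (length_fW e)

/-- **Reading the field `fM`.** [folklore] -/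
theorem sl_fM : sl S (offM ℓ (𝔭 ^ te) (2 ^ ℓ)) (τ + 1) = fM e := by
  have hoff : offM ℓ (𝔭 ^ te) (2 ^ ℓ) = (fI e).length + ((fZ e).length + ((fW e).length)) := by
    simp only [length_fI, length_fW, length_fZ, offM, offWP, offZ]
    try ring
  rw [hoff, extList, sl_append_right, sl_append_right, sl_append_right']
  exact sl_append_zero' _ _ (length_fM e)

/-- **Reading the field `fF`.** [folklore] -/
theorem sl_fF : sl S (offFil ℓ (𝔭 ^ te) (2 ^ ℓ) τ) (2 ^ τ * 2 * (2 ^ κ * n + 2 ^ κ * β)) = fF e := by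
  have hoff : offFil ℓ (𝔭 ^ te) (2 ^ ℓ) τ = (fI e).length + ((fZ e).length + ((fW e).length + ((fM e).length))) := by
    simp only [length_fI, length_fM, length_fW, length_fZ, offFil, offM, offWP, offZ]
    try ring
  rw [hoff, extList, sl_append_right, sl_append_right, sl_append_right, sl_append_right']
  exact sl_append_zero' _ _ (length_fF e)

/-- **Reading the field `fL`.** [folklore] -/
theorem sl_fL : sl S (offLab n (2 ^ κ) β (2 ^ τ) ℓ (𝔭 ^ te) (2 ^ ℓ) τ) (2 ^ τ * 2 * β) = fL e := by
  have hoff : offLab n (2 ^ κ) β (2 ^ τ) ℓ (𝔭 ^ te) (2 ^ ℓ) τ = (fI e).length + ((fZ e).length + ((fW e).length + ((fM e).length + ((fF e).length)))) := by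
    simp only [length_fF, length_fI, length_fM, length_fW, length_fZ, offLab, offFil, offM, offWP, offZ]
    try ring
  rw [hoff, extList, sl_append_right, sl_append_right, sl_append_right, sl_append_right, sl_append_right']
  exact sl_append_zero' _ _ (length_fL e)

/-- **Reading the field `fU`.** [folklore] -/
theorem sl_fU : sl S (offU n (2 ^ κ) β (2 ^ τ) ℓ (𝔭 ^ te) (2 ^ ℓ) τ) (β) = fU e := by
  have hoff : offU n (2 ^ κ) β (2 ^ τ) ℓ (𝔭 ^ te) (2 ^ ℓ) τ = (fI e).length + ((fZ e).length + ((fW e).length + ((fM e).length + ((fF e).length + ((fL e).length))))) := by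
    simp only [length_fF, length_fI, length_fL, length_fM, length_fW, length_fZ, offU, offLab, offFil, offM, offWP, offZ]
    try ring
  rw [hoff, extList, sl_append_right, sl_append_right, sl_append_right, sl_append_right, sl_append_right, sl_append_right']
  exact sl_append_zero' _ _ (length_fU e)

/-- **Reading the field `fU'`.** [folklore] -/
theorem sl_fUp : sl S (offU n (2 ^ κ) β (2 ^ τ) ℓ (𝔭 ^ te) (2 ^ ℓ) τ + β) (β) = fU' e := by
  have hoff : offU n (2 ^ κ) β (2 ^ τ) ℓ (𝔭 ^ te) (2 ^ ℓ) τ + β = (fI e).length + ((fZ e).length + ((fW e).length + ((fM e).length + ((fF e).length + ((fL e).length + ((fU e).length)))))) := by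
    simp only [length_fF, length_fI, length_fL, length_fM, length_fU, length_fW, length_fZ, offU, offLab, offFil, offM, offWP, offZ]
    try ring
  rw [hoff, extList, sl_append_right, sl_append_right, sl_append_right, sl_append_right, sl_append_right, sl_append_right, sl_append_right']
  exact sl_append_zero' _ _ (length_fUp e)

/-- **Reading the field `fS`.** [folklore] -/
theorem sl_fS : sl S (offSeeds n (2 ^ κ) β (2 ^ τ) ℓ (𝔭 ^ te) (2 ^ ℓ) τ) (kk * (2 ^ κ * β)) = fS e := by
  have hoff : offSeeds n (2 ^ κ) β (2 ^ τ) ℓ (𝔭 ^ te) (2 ^ ℓ) τ = (fI e).length + ((fZ e).length + ((fW e).length + ((fM e).length + ((fF e).length + ((fL e).length + ((fU e).length + ((fU' e).length))))))) := by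
    simp only [length_fF, length_fI, length_fL, length_fM, length_fU, length_fUp, length_fW, length_fZ, offSeeds, offU, offLab, offFil, offM, offWP, offZ]
    try ring
  rw [hoff, extList, sl_append_right, sl_append_right, sl_append_right, sl_append_right, sl_append_right, sl_append_right, sl_append_right, sl_append_right']
  exact sl_append_zero' _ _ (length_fS e)

/-- **Reading the field `fG`.** [folklore] -/
theorem sl_fG : sl S (offGuess n (2 ^ κ) β (2 ^ τ) ℓ (𝔭 ^ te) (2 ^ ℓ) kk τ) (kk * β) = fG e := by
  have hoff : offGuess n (2 ^ κ) β (2 ^ τ) ℓ (𝔭 ^ te) (2 ^ ℓ) kk τ = (fI e).length + ((fZ e).length + ((fW e).length + ((fM e).length + ((fF e).length + ((fL e).length + ((fU e).length + ((fU' e).length + ((fS e).length)))))))) := by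
    simp only [length_fF, length_fI, length_fL, length_fM, length_fS, length_fU, length_fUp, length_fW, length_fZ, offGuess, offSeeds, offU, offLab, offFil, offM, offWP, offZ]
    try ring
  rw [hoff, extList, sl_append_right, sl_append_right, sl_append_right, sl_append_right, sl_append_right, sl_append_right, sl_append_right, sl_append_right, sl_append_right']
  exact sl_append_zero' _ _ (length_fG e)

/-- **Reading the field `fP`.** [folklore] -/
theorem sl_fP : sl S (offPbP n (2 ^ κ) β (2 ^ τ) ℓ (𝔭 ^ te) (2 ^ ℓ) kk τ) (2 ^ κ) = fP e := by
  have hoff : offPbP n (2 ^ κ) β (2 ^ τ) ℓ (𝔭 ^ te) (2 ^ ℓ) kk τ = (fI e).length + ((fZ e).length + ((fW e).length + ((fM e).length + ((fF e).length + ((fL e).length + ((fU e).length + ((fU' e).length + ((fS e).length + ((fG e).length))))))))) := by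
    simp only [length_fF, length_fG, length_fI, length_fL, length_fM, length_fS, length_fU, length_fUp, length_fW, length_fZ, offPbP, offGuess, offSeeds, offU, offLab, offFil, offM, offWP, offZ]
    try ring
  rw [hoff, extList, sl_append_right, sl_append_right, sl_append_right, sl_append_right, sl_append_right, sl_append_right, sl_append_right, sl_append_right, sl_append_right, sl_append_right']
  exact sl_append_zero' _ _ (length_fP e)

/-- **Reading the field `fA`.** [folklore] -/
theorem sl_fA : sl S (offTup n (2 ^ κ) β (2 ^ τ) ℓ (𝔭 ^ te) (2 ^ ℓ) kk τ) (2 ^ κ * (n + β)) = fA e := by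
  have hoff : offTup n (2 ^ κ) β (2 ^ τ) ℓ (𝔭 ^ te) (2 ^ ℓ) kk τ = (fI e).length + ((fZ e).length + ((fW e).length + ((fM e).length + ((fF e).length + ((fL e).length + ((fU e).length + ((fU' e).length + ((fS e).length + ((fG e).length + ((fP e).length)))))))))) := by
    simp only [length_fF, length_fG, length_fI, length_fL, length_fM, length_fP, length_fS, length_fU, length_fUp, length_fW, length_fZ, offTup, offPbP, offGuess, offSeeds, offU, offLab, offFil, offM, offWP, offZ]
    try ring
  rw [hoff, extList, sl_append_right, sl_append_right, sl_append_right, sl_append_right, sl_append_right, sl_append_right, sl_append_right, sl_append_right, sl_append_right, sl_append_right, sl_append_right']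
  exact sl_append_zero' _ _ (length_fA e)

/-- **Reading the field `fT`.** [folklore] -/
theorem sl_fT : sl S (offSteps n (2 ^ κ) β (2 ^ τ) ℓ (𝔭 ^ te) (2 ^ ℓ) kk τ) (t * (κ + 2 ^ κ * (n + β))) = fT e := by
  have hoff : offSteps n (2 ^ κ) β (2 ^ τ) ℓ (𝔭 ^ te) (2 ^ ℓ) kk τ = (fI e).length + ((fZ e).length + ((fW e).length + ((fM e).length + ((fF e).length + ((fL e).length + ((fU e).length + ((fU' e).length + ((fS e).length + ((fG e).length + ((fP e).length + ((fA e).length))))))))))) := by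
    simp only [length_fA, length_fF, length_fG, length_fI, length_fL, length_fM, length_fP, length_fS, length_fU, length_fUp, length_fW, length_fZ, offSteps, offTup, offPbP, offGuess, offSeeds, offU, offLab, offFil, offM, offWP, offZ]
    try ring
  rw [hoff, extList, sl_append_right, sl_append_right, sl_append_right, sl_append_right, sl_append_right, sl_append_right, sl_append_right, sl_append_right, sl_append_right, sl_append_right, sl_append_right, sl_append_right']
  exact sl_append_zero' _ _ (length_fT e)

/-- **Reading the field `fQ`.** [folklore] -/
theorem sl_fQ : sl S (offJunk n (2 ^ κ) β (2 ^ τ) ℓ (𝔭 ^ te) (2 ^ ℓ) kk t κ τ) (β) = fQ e := by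
  have hoff : offJunk n (2 ^ κ) β (2 ^ τ) ℓ (𝔭 ^ te) (2 ^ ℓ) kk t κ τ = (fI e).length + ((fZ e).length + ((fW e).length + ((fM e).length + ((fF e).length + ((fL e).length + ((fU e).length + ((fU' e).length + ((fS e).length + ((fG e).length + ((fP e).length + ((fA e).length + ((fT e).length)))))))))))) := by
    simp only [length_fA, length_fF, length_fG, length_fI, length_fL, length_fM, length_fP, length_fS, length_fT, length_fU, length_fUp, length_fW, length_fZ, offJunk, offSteps, offTup, offPbP, offGuess, offSeeds, offU, offLab, offFil, offM, offWP, offZ, stepLenP]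
    try ring
  rw [hoff, extList, sl_append_right, sl_append_right, sl_append_right, sl_append_right, sl_append_right, sl_append_right, sl_append_right, sl_append_right, sl_append_right, sl_append_right, sl_append_right, sl_append_right, sl_append_right']
  have h := sl_zero_length (fQ e)
  rwa [length_fQ] at h

end Read

/-! ### Reading inside the fields -/

section ReadIn

variable {te ℓ n κ β τ kk t : ℕ} (hB : 0 < jB 𝔭 β) (e : ExtCoinsP te ℓ n κ β τ kk t)

local notation "S" => extList e
local notation "K" => 2 ^ κ
local notation "TT" => 2 ^ τ
local notation "Q" => 𝔭 ^ te

omit P in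
/-- Index arithmetic: item `i` of `K` items of length `c` fits. [folklore] -/
theorem item_fits {i m c : ℕ} (hi : i < m) : i * c + c ≤ m * c := by
  have := Nat.mul_le_mul_right c (hi : i + 1 ≤ m); rw [Nat.succ_mul] at this; exact this

/-- A filler point. [folklore] -/
theorem sl_filler_point (c : Fin (TT * 2)) (i : Fin K) :
    sl S (offFil ℓ Q (2 ^ ℓ) τ + c * (K * n + K * β) + i * n) n = List.ofFn ((e.1.1.1.1.2.2.1 c).1 i).1 := by
  have hin : (i : ℕ) * n + n ≤ K * n + K * β := (item_fits i.isLt).trans (Nat.le_add_right _ _)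
  have hc := item_fits (c := K * n + K * β) c.isLt
  rw [add_assoc, ← sl_sl S _ (TT * 2 * (K * n + K * β)) (by omega), sl_fF, fF, inputBits_eq_flatten,
    sl_flatten_ofFn _ (fun _ => length_blockBits _) c hin, sl_blockBits_point]

/-- A filler position block. [folklore] -/
theorem sl_filler_pos (c : Fin (TT * 2)) (i : Fin K) :
    sl S (offFil ℓ Q (2 ^ ℓ) τ + c * (K * n + K * β) + K * n + i * β) β = blkBits ((e.1.1.1.1.2.2.1 c).1 i).2 ((e.1.1.1.1.2.2.1 c).2 i) := by
  have hin : K * n + (i : ℕ) * β + β ≤ K * n + K * β := by have := item_fits (c := β) i.isLt; omega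
  have hc := item_fits (c := K * n + K * β) c.isLt
  rw [show offFil ℓ Q (2 ^ ℓ) τ + c * (K * n + K * β) + K * n + i * β = offFil ℓ Q (2 ^ ℓ) τ + (c * (K * n + K * β) + (K * n + i * β)) by ring,
    ← sl_sl S _ (TT * 2 * (K * n + K * β)) (by omega), sl_fF, fF, inputBits_eq_flatten,
    sl_flatten_ofFn _ (fun _ => length_blockBits _) c hin, sl_blockBits_pos]

/-- A label block. [folklore] -/
theorem sl_label (c : Fin (TT * 2)) : sl S (offLab n K β TT ℓ Q (2 ^ ℓ) τ + c * β) β = blkBits (e.2.1.1 c) (e.1.1.1.1.2.2.2.1 c) := by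
  have hc := item_fits (c := β) c.isLt
  rw [← sl_sl S _ (TT * 2 * β) hc, sl_fL, fL, ← Nat.add_zero ((c : ℕ) * β), sl_flatten_ofFn _ (fun _ => length_blkBits _ _) c (by omega),
    sl_zero_blkBits]

/-- A seed block. [folklore] -/
theorem sl_seed (tt : Fin kk) (j : Fin K) :
    sl S (offSeeds n K β TT ℓ Q (2 ^ ℓ) τ + (tt * K + j) * β) β = blkBits (e.2.1.2.2.1 tt j) (e.1.1.1.2.1 tt j) := by
  have hj := item_fits (c := β) j.isLt
  have htt := item_fits (c := K * β) tt.isLt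
  rw [show (tt * K + j : ℕ) * β = tt * (K * β) + j * β by ring, ← sl_sl S _ (kk * (K * β)) (by nlinarith), sl_fS, fS,
    sl_flatten_ofFn _ (fun _ => length_flatten_ofFn _ fun _ => length_blkBits _ _) tt hj, ← Nat.add_zero ((j : ℕ) * β),
    sl_flatten_ofFn _ (fun _ => length_blkBits _ _) j (by omega), sl_zero_blkBits]

/-- A guess block. [folklore] -/
theorem sl_guess (tt : Fin kk) : sl S (offGuess n K β TT ℓ Q (2 ^ ℓ) kk τ + tt * β) β = blkBits (e.2.1.2.2.2 tt) (e.1.1.1.2.2 tt) := by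
  have htt := item_fits (c := β) tt.isLt
  rw [← sl_sl S _ (kk * β) htt, sl_fG, fG, ← Nat.add_zero ((tt : ℕ) * β), sl_flatten_ofFn _ (fun _ => length_blkBits _ _) tt (by omega),
    sl_zero_blkBits]

/-- A DP-tuple point. [folklore] -/
theorem sl_tuple_point (i : Fin K) : sl S (offTup n K β TT ℓ Q (2 ^ ℓ) kk τ + i * (n + β)) n = List.ofFn (e.1.1.2.2.1 i).1 := by
  have hi := item_fits (c := n + β) i.isLt
  rw [← sl_sl S _ (K * (n + β)) (by omega), sl_fA, fA, ← Nat.add_zero ((i : ℕ) * (n + β)),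
    sl_flatten_ofFn _ (fun _ => by rw [List.length_append, List.length_ofFn, length_blkBits]) i (by omega)]
  exact sl_append_zero' _ _ List.length_ofFn

/-- A DP-tuple junk block. [folklore] -/
theorem sl_tuple_blk (i : Fin K) : sl S (offTup n K β TT ℓ Q (2 ^ ℓ) kk τ + i * (n + β) + n) β = blkBits (e.1.1.2.2.1 i).2 (e.2.2.1 i) := by
  have hi := item_fits (c := n + β) i.isLt
  rw [add_assoc, ← sl_sl S _ (K * (n + β)) (by omega), sl_fA, fA,
    sl_flatten_ofFn _ (fun _ => by rw [List.length_append, List.length_ofFn, length_blkBits]) i (by omega)]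
  have h := sl_append_right' (List.ofFn (e.1.1.2.2.1 i).1) (blkBits (e.1.1.2.2.1 i).2 (e.2.2.1 i)) β
  rw [List.length_ofFn] at h
  rw [h, sl_zero_blkBits]

omit P in
/-- The length of a step. [folklore] -/
theorem stepLenP_eq : stepLenP n K β κ = κ + K * (n + β) := rfl

/-- A step's index bits. [folklore] -/
theorem sl_step_idx (r : Fin t) : sl S (offSteps n K β TT ℓ Q (2 ^ ℓ) kk τ + r * stepLenP n K β κ) κ = lowBitsL κ ((e.1.1.2.2.2 r).1 : ℕ) := by
  have hr := item_fits (c := stepLenP n K β κ) r.isLt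
  rw [← sl_sl S _ (t * stepLenP n K β κ) (by rw [stepLenP_eq] at hr ⊢; omega), stepLenP_eq, sl_fT, fT, ← Nat.add_zero ((r : ℕ) * _),
    sl_flatten_ofFn _ (fun _ => by
      rw [List.length_append, length_lowBitsL, length_flatten_ofFn _ fun _ => by rw [List.length_append, List.length_ofFn, length_blkBits]]) r
      (by omega)]
  exact sl_append_zero' _ _ (length_lowBitsL _ _)

/-- A step's point. [folklore] -/
theorem sl_step_point (r : Fin t) (i : Fin K) :
    sl S (offSteps n K β TT ℓ Q (2 ^ ℓ) kk τ + r * stepLenP n K β κ + κ + i * (n + β)) n = List.ofFn ((e.1.1.2.2.2 r).2 i).1 := by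
  have hr := item_fits (c := stepLenP n K β κ) r.isLt
  have hi := item_fits (c := n + β) i.isLt
  rw [add_assoc, add_assoc, ← sl_sl S _ (t * stepLenP n K β κ) (by rw [stepLenP_eq] at hr ⊢; omega), stepLenP_eq, sl_fT, fT,
    sl_flatten_ofFn _ (fun _ => by
      rw [List.length_append, length_lowBitsL, length_flatten_ofFn _ fun _ => by rw [List.length_append, List.length_ofFn, length_blkBits]]) r
      (by omega),
    ← Nat.add_zero ((i : ℕ) * (n + β))]
  have h := sl_append_right (lowBitsL κ ((e.1.1.2.2.2 r).1 : ℕ))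
    (List.ofFn fun i => List.ofFn ((e.1.1.2.2.2 r).2 i).1 ++ blkBits ((e.1.1.2.2.2 r).2 i).2 (e.2.2.2.1 r i)).flatten ((i : ℕ) * (n + β) + 0) n
  rw [length_lowBitsL] at h
  rw [h, sl_flatten_ofFn _ (fun _ => by rw [List.length_append, List.length_ofFn, length_blkBits]) i (by omega)]
  exact sl_append_zero' _ _ List.length_ofFn

/-- A step's junk block. [folklore] -/
theorem sl_step_blk (r : Fin t) (i : Fin K) :
    sl S (offSteps n K β TT ℓ Q (2 ^ ℓ) kk τ + r * stepLenP n K β κ + κ + i * (n + β) + n) β = blkBits ((e.1.1.2.2.2 r).2 i).2 (e.2.2.2.1 r i) := by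
  have hr := item_fits (c := stepLenP n K β κ) r.isLt
  have hi := item_fits (c := n + β) i.isLt
  rw [add_assoc, add_assoc, add_assoc, ← sl_sl S _ (t * stepLenP n K β κ) (by rw [stepLenP_eq] at hr ⊢; omega), stepLenP_eq, sl_fT, fT,
    sl_flatten_ofFn _ (fun _ => by
      rw [List.length_append, length_lowBitsL, length_flatten_ofFn _ fun _ => by rw [List.length_append, List.length_ofFn, length_blkBits]]) r
      (by omega)]
  have h := sl_append_right (lowBitsL κ ((e.1.1.2.2.2 r).1 : ℕ))
    (List.ofFn fun i => List.ofFn ((e.1.1.2.2.2 r).2 i).1 ++ blkBits ((e.1.1.2.2.2 r).2 i).2 (e.2.2.2.1 r i)).flatten ((i : ℕ) * (n + β) + n) β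
  rw [length_lowBitsL] at h
  rw [h, sl_flatten_ofFn _ (fun _ => by rw [List.length_append, List.length_ofFn, length_blkBits]) i (by omega)]
  have h2 := sl_append_right' (List.ofFn ((e.1.1.2.2.2 r).2 i).1) (blkBits ((e.1.1.2.2.2 r).2 i).2 (e.2.2.2.1 r i)) β
  rw [List.length_ofFn] at h2
  rw [h2, sl_zero_blkBits]

end ReadIn

/-! ### The writer is a section of the reader; validity -/

section SectionThm

variable {te ℓ n κ β τ kk t : ℕ} (hB : 0 < jB 𝔭 β) (e : ExtCoinsP te ℓ n κ β τ kk t)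

local notation "S" => extList e
local notation "K" => 2 ^ κ
local notation "TT" => 2 ^ τ
local notation "Q" => 𝔭 ^ te

/-- **Field 0**: the block index. [folklore] -/
theorem read_i : boolFunEquivFin ℓ (rdBits S 0 ℓ) = e.1.1.1.1.1.1 := by
  rw [rdBits_of_sl_eq (g := (boolFunEquivFin ℓ).symm e.1.1.1.1.1.1) (sl_fI e), Equiv.apply_symm_apply]

/-- **Field 3**: the hybrid index. [folklore] -/
theorem read_m : slv S (offM ℓ Q (2 ^ ℓ)) (τ + 1) % (TT * 2) = (e.1.1.1.1.2.1 : ℕ) := by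
  have hlt : (e.1.1.1.1.2.1 : ℕ) < 2 ^ (τ + 1) := lt_of_lt_of_eq e.1.1.1.1.2.1.isLt (pow_succ 2 τ).symm
  rw [slv, sl_fM, fM, bitsToNat_lowBitsL hlt, Nat.mod_eq_of_lt (lt_of_lt_of_eq hlt (pow_succ 2 τ))]

/-- **A step's index.** [folklore] -/
theorem read_stepIdx (r : Fin t) : slv S (offSteps n K β TT ℓ Q (2 ^ ℓ) kk τ + r * stepLenP n K β κ) κ % K = ((e.1.1.2.2.2 r).1 : ℕ) := by
  rw [slv, sl_step_idx, bitsToNat_lowBitsL (e.1.1.2.2.2 r).1.isLt, Nat.mod_eq_of_lt (e.1.1.2.2.2 r).1.isLt]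

/-- **The layout writer is a section of the coin reader**: `coinsToExtP (extList e) = e`. [folklore] -/
theorem coinsToExtP_extList : coinsToExtP te ℓ n κ β τ kk t hB (extList e) = e := by
  have hfilP := fun c i => read_block hB (sl_filler_pos e c i)
  have hlab := fun c => read_block hB (sl_label e c)
  have hu := read_block hB (sl_fU e)
  have hu' := read_block hB (sl_fUp e)
  have hsd := fun tt j => read_block hB (sl_seed e tt j)
  have hσ := fun tt => read_block hB (sl_guess e tt)
  have ha := fun i => read_block hB (sl_tuple_blk e i)
  have hst := fun r i => read_block hB (sl_step_blk e r i)
  have hq := read_block hB (sl_fQ e)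
  refine Prod.ext (Prod.ext (Prod.ext (Prod.ext (Prod.ext ?_ ?_) ?_) ?_) ?_) ?_
  · -- advice `(i, z, w)`
    exact Prod.ext (read_i e) (Prod.ext (rdBits_of_sl_eq (sl_fZ e)) (rdBits_of_sl_eq (sl_fW e)))
  · -- vN coins `(m, fillers, labels, u, u')`
    refine Prod.ext (Fin.ext (read_m e)) (Prod.ext ?_ (Prod.ext ?_ (Prod.ext hu.2.2.1 hu'.2.2.1)))
    · funext c
      refine Prod.ext (funext fun i => Prod.ext ?_ (hfilP c i).2.2.2) (funext fun i => (hfilP c i).2.2.1)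
      exact rdBits_of_sl_eq (sl_filler_point e c i)
    · funext c; exact (hlab c).2.2.1
  · -- GL coins `(s, σ)`
    exact Prod.ext (funext fun tt => funext fun j => (hsd tt j).2.2.1) (funext fun tt => (hσ tt).2.2.1)
  · -- DP coins `(Pb, a, steps)`
    refine Prod.ext (rdBits_of_sl_eq (sl_fP e)) (Prod.ext ?_ ?_)
    · funext i; exact Prod.ext (rdBits_of_sl_eq (sl_tuple_point e i)) (ha i).2.2.2
    · funext r
      refine Prod.ext (Fin.ext (read_stepIdx e r)) (funext fun i => Prod.ext (rdBits_of_sl_eq (sl_step_point e r i)) (hst r i).2.2.2)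
  · -- `q₀`
    exact hq.2.2.2
  · -- the extras
    refine Prod.ext (Prod.ext (funext fun c => (hlab c).2.2.2) (Prod.ext (Prod.ext hu.2.2.2 hu'.2.2.2) (Prod.ext
      (funext fun tt => funext fun j => (hsd tt j).2.2.2) (funext fun tt => (hσ tt).2.2.2)))) ?_
    exact Prod.ext (funext fun i => (ha i).2.2.1) (Prod.ext (funext fun r => funext fun i => (hst r i).2.2.1) hq.2.2.1)

include hB in
/-- **The written segment is valid.** [folklore] -/
theorem validSeg_extList : ValidSeg te ℓ n κ β τ kk t (extList e) :=
  ⟨fun c i => (read_block hB (sl_filler_pos e c i)).2.1, fun c => (read_block hB (sl_label e c)).2.1, (read_block hB (sl_fU e)).2.1,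
    (read_block hB (sl_fUp e)).2.1, fun tt j => (read_block hB (sl_seed e tt j)).2.1, fun tt => (read_block hB (sl_guess e tt)).2.1,
    fun i => (read_block hB (sl_tuple_blk e i)).2.1, fun r i => (read_block hB (sl_step_blk e r i)).2.1, (read_block hB (sl_fQ e)).2.1⟩

include hB in
/-- **The layout writer is injective.** [folklore] -/
theorem extList_injective : Function.Injective (extList (te := te) (ℓ := ℓ) (n := n) (κ := κ) (β := β) (τ := τ) (kk := kk) (t := t)) :=
  fun e e' h => by rw [← coinsToExtP_extList hB e, ← coinsToExtP_extList hB e', h]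

/-- The run coins of the written segment. [folklore] -/
theorem coinsToRunP_extList : coinsToRunP te ℓ n κ β τ kk t hB (extList e) = e.1 := congrArg Prod.fst (coinsToExtP_extList hB e)

end SectionThm

/-! ### Counting the extended coins -/

section Card

-- the nested coin products exceed the default instance size bound
set_option synthInstance.maxSize 2048
set_option synthInstance.maxHeartbeats 400000

variable (te ℓ n κ β τ kk t : ℕ)

/-- **The number of `β`-blocks of a run.** [folklore] -/
def nBlocks (κ τ kk t : ℕ) : ℕ := 2 ^ τ * 2 * 2 ^ κ + 2 ^ τ * 2 + 2 + kk * 2 ^ κ + kk + 2 ^ κ + t * 2 ^ κ + 1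

/-- The non-block bits of a run. [folklore] -/
def nFree (te ℓ n κ τ t : ℕ) : ℕ :=
  ℓ + 𝔭 ^ te * 𝔭 ^ te + 2 ^ ℓ + (τ + 1) + 2 ^ τ * 2 * (2 ^ κ * n) + 2 ^ κ + 2 ^ κ * n + t * (κ + 2 ^ κ * n)

/-- The run length splits into free bits and blocks. [folklore] -/
theorem runLenP_eq_free_add : runLenP n (2 ^ κ) β (2 ^ τ) ℓ (𝔭 ^ te) (2 ^ ℓ) kk t κ τ = nFree te ℓ n κ τ t + β * nBlocks κ τ kk t := by
  unfold runLenP offJunk offSteps offTup offPbP offGuess offSeeds offU offLab offFil offM offWP offZ stepLenP nFree nBlocks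
  ring

/-- **The number of extended coin tuples**: `2^{free} · (B p)^{blocks}`. [folklore] -/
theorem card_ExtCoinsP : Fintype.card (ExtCoinsP te ℓ n κ β τ kk t) = 2 ^ nFree te ℓ n κ τ t * (jB 𝔭 β * 𝔭) ^ nBlocks κ τ kk t := by
  have hp : Fintype.card (ZMod 𝔭) = 𝔭 := ZMod.card 𝔭
  simp only [Fintype.card_prod, Fintype.card_fun, Fintype.card_fin, Fintype.card_bool, hp]
  rw [nFree, nBlocks]
  ring

/-- **The extended coins are at least a `1 - p N_b / 2^β` fraction of the coin segments.** [folklore] -/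
theorem card_ExtCoinsP_ge (hβ : 𝔭 ≤ 2 ^ β) :
    (1 - (𝔭 : ℝ) * nBlocks κ τ kk t / (2 : ℝ) ^ β) * (2 : ℝ) ^ runLenP n (2 ^ κ) β (2 ^ τ) ℓ (𝔭 ^ te) (2 ^ ℓ) kk t κ τ ≤
      Fintype.card (ExtCoinsP te ℓ n κ β τ kk t) := by
  rw [card_ExtCoinsP, runLenP_eq_free_add, pow_add, pow_mul]
  push_cast
  have h2β : (0 : ℝ) < (2 : ℝ) ^ β := by positivity
  -- `B p ≥ 2^β - p`, i.e. `B p / 2^β ≥ 1 - p/2^β`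
  have hjB : (2 : ℝ) ^ β * (1 - 𝔭 / (2 : ℝ) ^ β) ≤ (jB 𝔭 β : ℝ) * 𝔭 := by
    have h := lt_jB_mul_add (p := 𝔭) (β := β)
    have h' : ((2 ^ β : ℕ) : ℝ) < ((jB 𝔭 β * 𝔭 + 𝔭 : ℕ) : ℝ) := by exact_mod_cast h
    push_cast at h'
    rw [mul_sub, mul_one, mul_div_cancel₀ _ h2β.ne']
    linarith
  have hx : -2 ≤ -((𝔭 : ℝ) / (2 : ℝ) ^ β) := by
    have : (𝔭 : ℝ) / (2 : ℝ) ^ β ≤ 1 := by rw [div_le_one h2β]; exact_mod_cast hβ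
    linarith
  have hbern := one_add_mul_le_pow hx (nBlocks κ τ kk t)
  have hpow : ((2 : ℝ) ^ β) ^ nBlocks κ τ kk t * (1 - 𝔭 * nBlocks κ τ kk t / (2 : ℝ) ^ β) ≤ ((jB 𝔭 β : ℝ) * 𝔭) ^ nBlocks κ τ kk t := by
    calc ((2 : ℝ) ^ β) ^ nBlocks κ τ kk t * (1 - 𝔭 * nBlocks κ τ kk t / (2 : ℝ) ^ β)
        = ((2 : ℝ) ^ β) ^ nBlocks κ τ kk t * (1 + nBlocks κ τ kk t * -((𝔭 : ℝ) / (2 : ℝ) ^ β)) := by ring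
      _ ≤ ((2 : ℝ) ^ β) ^ nBlocks κ τ kk t * (1 + -((𝔭 : ℝ) / (2 : ℝ) ^ β)) ^ nBlocks κ τ kk t :=
          mul_le_mul_of_nonneg_left hbern (by positivity)
      _ = ((2 : ℝ) ^ β * (1 - 𝔭 / (2 : ℝ) ^ β)) ^ nBlocks κ τ kk t := by rw [← mul_pow]; ring
      _ ≤ ((jB 𝔭 β : ℝ) * 𝔭) ^ nBlocks κ τ kk t := by
          apply pow_le_pow_left₀ _ hjB
          have : (𝔭 : ℝ) / (2 : ℝ) ^ β ≤ 1 := by rw [div_le_one h2β]; exact_mod_cast hβ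
          nlinarith
  calc (1 - (𝔭 : ℝ) * nBlocks κ τ kk t / (2 : ℝ) ^ β) * ((2 : ℝ) ^ nFree te ℓ n κ τ t * ((2 : ℝ) ^ β) ^ nBlocks κ τ kk t)
      = (2 : ℝ) ^ nFree te ℓ n κ τ t * (((2 : ℝ) ^ β) ^ nBlocks κ τ kk t * (1 - 𝔭 * nBlocks κ τ kk t / (2 : ℝ) ^ β)) := by ring
    _ ≤ (2 : ℝ) ^ nFree te ℓ n κ τ t * ((jB 𝔭 β : ℝ) * 𝔭) ^ nBlocks κ τ kk t := mul_le_mul_of_nonneg_left hpow (by positivity)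

end Card

end Modp

end Literature.Computability.Learning


/-!
## Part — The `AC⁰[p]` learner: candidates, validation and selection (the output function)

Machine-layer groundwork for the named fact `Literature.Computability.Learning.cikk_learn_AC0Mod`
(CIKK 2016, Cor. 5.4): the output function `G` of the truth-table transducer `ttFnAlg Q q G` — from
the learner input `⟨⟨1ⁿ, ⟨1ᵃ, 1ᵇ⟩⟩, r⟩` and the membership answers it builds, for every processed
level `ℓ` and run `ρ`, the candidate hypothesis string (`candN`: `HypPFP.hypN` on the level record,
the run's coin segment and the run's answers), validates it on the level's `M` sample points
against the answers (`errsN`, `passesN`: the test `4a · errs ≤ 3M`), selects the first passing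
candidate of the first level that has one (`levelSelN`, `gOutN`), as a typed recipe and a
polynomial-time code (`gPFn dR ∈ FP` for a decision procedure `dR ∈ FP` of the natural property,
`gPFn_apply`). The hypothesis of run `(ℓ, ρ)` as a Boolean function is, by definition, what the
evaluator `EvalPFP.evalPFn dR` computes on the candidate (`hypOfP`); its closed form on valid coin
segments is the business of the analysis.

## References

* M. Carmosino, R. Impagliazzo, V. Kabanets, A. Kolokolova, *Learning algorithms from natural
  proofs*, CCC 2016, §5 (complete algorithm; repetition and validation) [CarmosinoImpagliazzoKabanetsKolokolova2016].
* M. Kearns, U. Vazirani, *An Introduction to Computational Learning Theory*, MIT Press 1994, §1.2 (hypothesis testing) [KearnsVazirani1994].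
-/

open Polynomial

namespace Literature.Computability.Learning

namespace Modp

open Literature.Computability.Complexity Literature.Computability.Complexity.GaussRank
  Literature.Computability.Cryptography Literature.Computability.MetaComplexity _root_.Computability CodeFP Finset

variable [P : PrimeP]

/-! ### The typed recipe -/

section Recipe

variable (dR : List Bool → List Bool) (n a b : ℕ) (r ans : List Bool)

/-- **The candidate string of run `ρ` of level `ℓ`** (capped record and slices; on a processed level
the genuine ones). [cite: CarmosinoImpagliazzoKabanetsKolokolova2016, §5 (complete algorithm)] -/
noncomputable def candN (ℓ ρ : ℕ) : List Bool :=
  hypOutE 𝔭 (hypN (prmCapN n a b r.length ℓ) (sl r (min (lvlCoffP n a b ℓ + ρ * lvlSlotP n a b ℓ) r.length) (min (lvlRunLenP n a b ℓ) r.length))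
    (sl ans (min (qoffP n a b ℓ + ρ * nQRunP n a b ℓ) ans.length) (min (nQRunP n a b ℓ) r.length)))

/-- The validation point `w` of level `ℓ` (capped offset). [folklore] -/
def valPtC (ℓ w : ℕ) : List Bool := sl r (min (lvlCoffP n a b ℓ + RepsP n a b ℓ * lvlSlotP n a b ℓ + w * n) r.length) n

/-- The prediction of the candidate at a point: the evaluator's bit. [folklore] -/
noncomputable def predN (cand pt : List Bool) : Bool := (evalPFn dR (boolPair cand pt)).getD 0 false

/-- **The empirical error count** of run `ρ` of level `ℓ` on the level's validation sample. [folklore] -/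
noncomputable def errsN (ℓ ρ : ℕ) : ℕ :=
  ((List.range (min (MP n a b ℓ) r.length)).filter fun w =>
    (predN dR (candN n a b r ans ℓ ρ) (valPtC n a b r ℓ w)) != valAnsN n a b ans ℓ w).length

/-- **The validation test** `4a · errs ≤ 3M`. [folklore] -/
noncomputable def passesN (ℓ ρ : ℕ) : Bool := decide (4 * a * errsN dR n a b r ans ℓ ρ ≤ 3 * MP n a b ℓ)

/-- Emptiness of a list of naturals as a Boolean. [folklore] -/
def isEmptyB (l : List ℕ) : Bool := decide (l.length = 0)

/-- The passing runs of level `ℓ`. [folklore] -/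
noncomputable def passingN (ℓ : ℕ) : List ℕ := (List.range (min (RepsP n a b ℓ) r.length)).filter (passesN dR n a b r ans ℓ)

/-- **The selection of level `ℓ`**: the first passing candidate (`ε` if none or if the level is not
processed). [cite: CarmosinoImpagliazzoKabanetsKolokolova2016, §5] -/
noncomputable def levelSelN (ℓ : ℕ) : List Bool :=
  if decide (lvlCoffP n a b (ℓ + 1) ≤ r.length) then
    if isEmptyB (passingN dR n a b r ans ℓ) then [] else candN n a b r ans ℓ ((passingN dR n a b r ans ℓ).headD 0)
  else []

/-- The levels with a nonempty selection. [folklore] -/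
noncomputable def goodLvlsN : List ℕ := (List.range (r.length + 1)).filter fun ℓ => !decide ((levelSelN dR n a b r ans ℓ).length ≤ 0)

/-- **The output**: the selection of the first level that has one. [cite: CarmosinoImpagliazzoKabanetsKolokolova2016, §5] -/
noncomputable def gOutN : List Bool :=
  if isEmptyB (goodLvlsN dR n a b r ans) then [] else levelSelN dR n a b r ans ((goodLvlsN dR n a b r ans).headD 0)

/-- **The hypothesis of run `(ℓ, ρ)` as a Boolean function**: the evaluator on the candidate. [folklore] -/
noncomputable def hypOfP (ℓ ρ : ℕ) : (Fin n → Bool) → Bool := fun x => predN dR (candN n a b r ans ℓ ρ) (List.ofFn x)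

end Recipe

/-! ### What the recipe selects -/

section Spec

variable {dR : List Bool → List Bool} {n a b : ℕ} {r ans : List Bool}

omit P in
/-- A string of length `n` is the string of its bits. [folklore] -/
theorem ofFn_rdBits_of_length {s : List Bool} {n : ℕ} (hs : s.length = n) : List.ofFn (rdBits s 0 n) = s := by
  rw [← sl_eq_ofFn s (by omega), sl, List.drop_zero, List.takeD_eq_take _ (by omega), List.take_of_length_le (by omega)]

/-- On a processed level the candidate uses the genuine record and segment. [folklore] -/
theorem candN_eq {ℓ : ℕ} (h : LvlProcessedP n a b r.length ℓ) (ρ : ℕ) :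
    candN n a b r ans ℓ ρ = hypOutE 𝔭 (hypN (prmLvl n a b ℓ) (lvlSegP n a b r ℓ ρ) (runAnsN n a b ans ℓ ρ)) := by
  have hnq : nQRunP n a b ℓ ≤ r.length := by
    have h1 : nQRunP n a b ℓ ≤ lvlSlotP n a b ℓ := Nat.le_add_left _ _
    have h2 : lvlSlotP n a b ℓ ≤ RepsP n a b ℓ * lvlSlotP n a b ℓ := Nat.le_mul_of_pos_left _ (Nat.two_pow_pos _)
    have hb : lvlCoffP n a b ℓ + lvlBlockLenP n a b ℓ ≤ r.length := by
      have := h; unfold LvlProcessedP lvlCoffP at this; rwa [Finset.sum_range_succ] at this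
    unfold lvlBlockLenP at hb; omega
  rw [candN, prmCapN_eq n a b h, sl_min_length, sl_min_length, min_eq_left (runLen_le_of_processed n a b h).1, min_eq_left hnq, lvlSegP, runAnsN]

/-- The capped validation point is the validation point. [folklore] -/
theorem valPtC_eq (ℓ w : ℕ) : valPtC n a b r ℓ w = lvlValPtP n a b r ℓ w := by rw [valPtC, sl_min_length, lvlValPtP]

/-- On a processed level the passing runs range over all `Reps` runs. [folklore] -/
theorem passingN_eq {ℓ : ℕ} (h : LvlProcessedP n a b r.length ℓ) :
    passingN dR n a b r ans ℓ = (List.range (RepsP n a b ℓ)).filter (passesN dR n a b r ans ℓ) := by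
  rw [passingN, min_eq_left (runLen_le_of_processed n a b h).2.1]

/-- **The error count is the number of sample points the hypothesis gets wrong**, under the true
answers (enough of them). [folklore] -/
theorem errsN_eq {f : (Fin n → Bool) → Bool} {ℓ : ℕ} (h : LvlProcessedP n a b r.length ℓ) (ρ : ℕ) {q : ℕ}
    (hq : qoffP n a b ℓ + lvlNQP n a b ℓ ≤ q) :
    errsN dR n a b r (ansListP n a b r f q) ℓ ρ = ((Finset.range (MP n a b ℓ)).filter fun w =>
      hypOfP dR n a b r (ansListP n a b r f q) ℓ ρ (rdBits (lvlValPtP n a b r ℓ w) 0 n) ≠ f (rdBits (lvlValPtP n a b r ℓ w) 0 n)).card := by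
  rw [errsN, min_eq_left (runLen_le_of_processed n a b h).2.2, ← List.toFinset_card_of_nodup ((List.nodup_range).filter _), List.toFinset_filter,
    List.toFinset_range]
  refine congrArg Finset.card (Finset.filter_congr fun w hw => ?_)
  rw [Finset.mem_range] at hw
  rw [valAnsN_eq f h hw hq, hypOfP, valPtC_eq, bne_iff_ne, ne_eq, ofFn_rdBits_of_length (s := lvlValPtP n a b r ℓ w) (length_sl _ _ _)]

end Spec

/-! ### The recipe as a polynomial-time code -/

section Code

variable {dR : List Bool → List Bool} (hdR : dR ∈ FP)

/-- The typed `G`-input `⟨⟨prms, r⟩, ans⟩`. [folklore] -/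
abbrev GInT : Type := LrnInT × List Bool

/-- Its code (`= boolPair (boolPair (pacParams n a b) r) ans`). [folklore] -/
abbrev gInE : GInT → List Bool := pairE lrnInE strE

/-- The hypothesis record as a string is a code. [folklore] -/
theorem hypStr_code : CodeFP hypInE strE (fun a => hypOutE 𝔭 (hypN a.1 a.2.1 a.2.2)) := by
  obtain ⟨F, hF, hspec⟩ := hypN_code (P := P)
  exact ⟨F, hF, hspec⟩

include hdR in
/-- The prediction is a code. [folklore] -/
theorem predN_code : CodeFP (pairE strE strE) bitE (fun t => predN dR t.1 t.2) := by
  have hE : CodeFP (pairE strE strE) strE (fun t => evalPFn dR (boolPair t.1 t.2)) := ⟨evalPFn dR, evalPFn_mem_FP hdR, fun _ => rfl⟩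
  exact (strGetDNat.comp (hE.pair (const _ 0))).congr fun _ => rfl

/-- `qoffP` is a code on the level argument. [folklore] -/
theorem qoff_code : CodeFP lvlArgE natE (fun x => qoffP x.1.1 x.1.2.1 x.1.2.2 x.2) := by
  have hitem : CodeFP (pairE lvlArgE natE) natE (fun s => lvlNQP s.1.1.1 s.1.1.2.1 s.1.1.2.2 (min s.2 s.1.2)) := by
    have hx : CodeFP (pairE lvlArgE natE) lvlArgE (fun s => (s.1.1, min s.2 s.1.2)) := ((fst _ _).fst'.pair (uidx_code (snd _ _))).congr fun _ => rfl
    exact (natAdd.comp ((natMul.comp (((LvlArg.Reps_code.comp hx).congr fun _ => rfl).pair ((LvlArg.nQRun_code.comp hx).congr fun _ => rfl))).pair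
      ((LvlArg.M_code.comp hx).congr fun _ => rfl))).congr fun _ => rfl
  refine ((natSum.comp ((CodeFP.map hitem).comp ((CodeFP.id _).pair (urange.comp (snd _ _))))).congr fun x => ?_)
  have h1 : ((List.range x.2).map fun ℓ' => lvlNQP x.1.1 x.1.2.1 x.1.2.2 (min ℓ' x.2)) = (List.range x.2).map fun ℓ' => lvlNQP x.1.1 x.1.2.1 x.1.2.2 ℓ' :=
    map_range_min x.2 _
  have h2 : qoffP x.1.1 x.1.2.1 x.1.2.2 x.2 = ((List.range x.2).map fun ℓ' => lvlNQP x.1.1 x.1.2.1 x.1.2.2 ℓ').sum := by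
    rw [qoffP, Finset.sum_range, ← List.sum_ofFn, ← map_range_eq_ofFn]
  rw [h2, ← h1]
  rfl

/-- The typed context `⟨⟨g, ℓ⟩, ρ⟩` of a run (both in binary). [folklore] -/
abbrev RunCtxT : Type := (GInT × ℕ) × ℕ

/-- Its code. [folklore] -/
abbrev runCtxE : RunCtxT → List Bool := pairE (pairE gInE natE) natE

namespace RunCtx
/-! Accessor codes on the run context `c = ⟨⟨⟨⟨prms, r⟩, ans⟩, ℓ⟩, ρ⟩`. -/

omit P in
/-- `prms`. [folklore] -/ theorem prms_code : CodeFP runCtxE (pairE unE (pairE unE unE)) (fun c : RunCtxT => c.1.1.1.1) := (fst _ _).fst'.fst'.fst'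
omit P in
/-- `r`. [folklore] -/ theorem r_code : CodeFP runCtxE strE (fun c : RunCtxT => c.1.1.1.2) := (fst _ _).fst'.fst'.snd'
omit P in
/-- `ans`. [folklore] -/ theorem ans_code : CodeFP runCtxE strE (fun c : RunCtxT => c.1.1.2) := (fst _ _).fst'.snd'
omit P in
/-- `R = |r|`. [folklore] -/ theorem R_code : CodeFP runCtxE unE (fun c : RunCtxT => c.1.1.1.2.length) := (strLength.comp r_code).congr fun _ => rfl
omit P in
/-- `ℓ` (capped, unary). [folklore] -/
theorem ℓ_code : CodeFP runCtxE unE (fun c : RunCtxT => min c.1.2 c.1.1.1.2.length) := (unOfNatMin.comp (R_code.pair (fst _ _).snd')).congr fun _ => rfl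
omit P in
/-- The level argument. [folklore] -/
theorem x_code : CodeFP runCtxE lvlArgE (fun c : RunCtxT => (c.1.1.1.1, min c.1.2 c.1.1.1.2.length)) := (prms_code.pair ℓ_code).congr fun _ => rfl
omit P in
/-- `ρ` (binary). [folklore] -/ theorem ρ_code : CodeFP runCtxE natE (fun c : RunCtxT => c.2) := snd _ _
omit P in
/-- `n`. [folklore] -/ theorem n_code : CodeFP runCtxE unE (fun c : RunCtxT => c.1.1.1.1.1) := prms_code.fst'
omit P in
/-- `a`. [folklore] -/ theorem a_code : CodeFP runCtxE unE (fun c : RunCtxT => c.1.1.1.1.2.1) := prms_code.snd'.fst'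

end RunCtx

/-- The capped candidate on the run context. [folklore] -/
noncomputable def candC (c : RunCtxT) : List Bool :=
  candN c.1.1.1.1.1 c.1.1.1.1.2.1 c.1.1.1.1.2.2 c.1.1.1.2 c.1.1.2 (min c.1.2 c.1.1.1.2.length) c.2

/-- **The candidate is a code** on the run context. [folklore] -/
theorem cand_code : CodeFP runCtxE strE candC := by
  have hx := RunCtx.x_code
  have hR := RunCtx.R_code
  have hr := RunCtx.r_code
  have hρ := RunCtx.ρ_code
  have hπ : CodeFP runCtxE prmE (fun c => prmCapN c.1.1.1.1.1 c.1.1.1.1.2.1 c.1.1.1.1.2.2 c.1.1.1.2.length (min c.1.2 c.1.1.1.2.length)) :=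
    (prmCap_code.comp (hx.pair hR)).congr fun _ => rfl
  have hcoff : CodeFP runCtxE natE (fun c => lvlCoffP c.1.1.1.1.1 c.1.1.1.1.2.1 c.1.1.1.1.2.2 (min c.1.2 c.1.1.1.2.length)) := (coff_code.comp hx).congr fun _ => rfl
  have hslot : CodeFP runCtxE natE (fun c => lvlSlotP c.1.1.1.1.1 c.1.1.1.1.2.1 c.1.1.1.1.2.2 (min c.1.2 c.1.1.1.2.length)) := (LvlArg.slot_code.comp hx).congr fun _ => rfl
  have hrun : CodeFP runCtxE natE (fun c => lvlRunLenP c.1.1.1.1.1 c.1.1.1.1.2.1 c.1.1.1.1.2.2 (min c.1.2 c.1.1.1.2.length)) := (LvlArg.runLen_code.comp hx).congr fun _ => rfl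
  have hnq : CodeFP runCtxE natE (fun c => nQRunP c.1.1.1.1.1 c.1.1.1.1.2.1 c.1.1.1.1.2.2 (min c.1.2 c.1.1.1.2.length)) := (LvlArg.nQRun_code.comp hx).congr fun _ => rfl
  have hqoff : CodeFP runCtxE natE (fun c => qoffP c.1.1.1.1.1 c.1.1.1.1.2.1 c.1.1.1.1.2.2 (min c.1.2 c.1.1.1.2.length)) := (qoff_code.comp hx).congr fun _ => rfl
  have hoff : CodeFP runCtxE unE (fun c => min (lvlCoffP c.1.1.1.1.1 c.1.1.1.1.2.1 c.1.1.1.1.2.2 (min c.1.2 c.1.1.1.2.length) +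
      c.2 * lvlSlotP c.1.1.1.1.1 c.1.1.1.1.2.1 c.1.1.1.1.2.2 (min c.1.2 c.1.1.1.2.length)) c.1.1.1.2.length) :=
    (unOfNatMin.comp (hR.pair (natAdd.comp (hcoff.pair (natMul.comp (hρ.pair hslot)))))).congr fun _ => rfl
  have hrunU : CodeFP runCtxE unE (fun c => min (lvlRunLenP c.1.1.1.1.1 c.1.1.1.1.2.1 c.1.1.1.1.2.2 (min c.1.2 c.1.1.1.2.length)) c.1.1.1.2.length) :=
    (unOfNatMin.comp (hR.pair hrun)).congr fun _ => rfl
  have hseg := sl_code hoff hrunU hr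
  have hA : CodeFP runCtxE unE (fun c => c.1.1.2.length) := (strLength.comp RunCtx.ans_code).congr fun _ => rfl
  have haoff : CodeFP runCtxE unE (fun c => min (qoffP c.1.1.1.1.1 c.1.1.1.1.2.1 c.1.1.1.1.2.2 (min c.1.2 c.1.1.1.2.length) +
      c.2 * nQRunP c.1.1.1.1.1 c.1.1.1.1.2.1 c.1.1.1.1.2.2 (min c.1.2 c.1.1.1.2.length)) c.1.1.2.length) :=
    (unOfNatMin.comp (hA.pair (natAdd.comp (hqoff.pair (natMul.comp (hρ.pair hnq)))))).congr fun _ => rfl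
  have hnqU : CodeFP runCtxE unE (fun c => min (nQRunP c.1.1.1.1.1 c.1.1.1.1.2.1 c.1.1.1.1.2.2 (min c.1.2 c.1.1.1.2.length)) c.1.1.1.2.length) :=
    (unOfNatMin.comp (hR.pair hnq)).congr fun _ => rfl
  have hans := sl_code haoff hnqU RunCtx.ans_code
  exact (hypStr_code.comp (hπ.pair (hseg.pair hans))).congr fun c => by simp only [candC, candN]

end Code

section Code2

variable {dR : List Bool → List Bool} (hdR : dR ∈ FP)

/-- The capped error count on the run context. [folklore] -/
noncomputable def errsC (dR : List Bool → List Bool) (c : RunCtxT) : ℕ :=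
  errsN dR c.1.1.1.1.1 c.1.1.1.1.2.1 c.1.1.1.1.2.2 c.1.1.1.2 c.1.1.2 (min c.1.2 c.1.1.1.2.length) c.2

/-- The capped test on the run context. [folklore] -/
noncomputable def passesC (dR : List Bool → List Bool) (c : RunCtxT) : Bool :=
  passesN dR c.1.1.1.1.1 c.1.1.1.1.2.1 c.1.1.1.1.2.2 c.1.1.1.2 c.1.1.2 (min c.1.2 c.1.1.1.2.length) c.2

/-- The capped selection on the level context `⟨g, ℓ⟩`. [folklore] -/
noncomputable def levelSelC (dR : List Bool → List Bool) (y : GInT × ℕ) : List Bool :=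
  levelSelN dR y.1.1.1.1 y.1.1.1.2.1 y.1.1.1.2.2 y.1.1.2 y.1.2 (min y.2 y.1.1.2.length)

omit P in
/-- Boolean disagreement as a conditional. [folklore] -/
theorem bne_eq_ite (p q : Bool) : (p != q) = (if p then !q else q) := by cases p <;> cases q <;> rfl

include hdR in
/-- **The error count is a code** on the run context. [folklore] -/
theorem errs_code : CodeFP runCtxE unE (errsC dR) := by
  -- item `w`
  let e₂ := pairE runCtxE natE
  have hc : CodeFP e₂ runCtxE (fun s => s.1) := fst _ _
  have hw : CodeFP e₂ natE (fun s => s.2) := snd _ _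
  have hx : CodeFP e₂ lvlArgE (fun s => (s.1.1.1.1.1, min s.1.1.2 s.1.1.1.1.2.length)) := (RunCtx.x_code.comp hc).congr fun _ => rfl
  have hR : CodeFP e₂ unE (fun s => s.1.1.1.1.2.length) := (RunCtx.R_code.comp hc).congr fun _ => rfl
  have hn : CodeFP e₂ unE (fun s => s.1.1.1.1.1.1) := (RunCtx.n_code.comp hc).congr fun _ => rfl
  have hcoff : CodeFP e₂ natE (fun s => lvlCoffP s.1.1.1.1.1.1 s.1.1.1.1.1.2.1 s.1.1.1.1.1.2.2 (min s.1.1.2 s.1.1.1.1.2.length)) := (coff_code.comp hx).congr fun _ => rfl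
  have hReps : CodeFP e₂ natE (fun s => RepsP s.1.1.1.1.1.1 s.1.1.1.1.1.2.1 s.1.1.1.1.1.2.2 (min s.1.1.2 s.1.1.1.1.2.length)) := (LvlArg.Reps_code.comp hx).congr fun _ => rfl
  have hslot : CodeFP e₂ natE (fun s => lvlSlotP s.1.1.1.1.1.1 s.1.1.1.1.1.2.1 s.1.1.1.1.1.2.2 (min s.1.1.2 s.1.1.1.1.2.length)) := (LvlArg.slot_code.comp hx).congr fun _ => rfl
  have hnq : CodeFP e₂ natE (fun s => nQRunP s.1.1.1.1.1.1 s.1.1.1.1.1.2.1 s.1.1.1.1.1.2.2 (min s.1.1.2 s.1.1.1.1.2.length)) := (LvlArg.nQRun_code.comp hx).congr fun _ => rfl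
  have hqoff : CodeFP e₂ natE (fun s => qoffP s.1.1.1.1.1.1 s.1.1.1.1.1.2.1 s.1.1.1.1.1.2.2 (min s.1.1.2 s.1.1.1.1.2.length)) := (qoff_code.comp hx).congr fun _ => rfl
  have hvoff : CodeFP e₂ unE (fun s => min (lvlCoffP s.1.1.1.1.1.1 s.1.1.1.1.1.2.1 s.1.1.1.1.1.2.2 (min s.1.1.2 s.1.1.1.1.2.length) +
      RepsP s.1.1.1.1.1.1 s.1.1.1.1.1.2.1 s.1.1.1.1.1.2.2 (min s.1.1.2 s.1.1.1.1.2.length) * lvlSlotP s.1.1.1.1.1.1 s.1.1.1.1.1.2.1 s.1.1.1.1.1.2.2 (min s.1.1.2 s.1.1.1.1.2.length) +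
      s.2 * s.1.1.1.1.1.1) s.1.1.1.1.2.length) :=
    (unOfNatMin.comp (hR.pair (natAdd.comp ((natAdd.comp (hcoff.pair (natMul.comp (hReps.pair hslot)))).pair (natMul.comp (hw.pair (natOfUn.comp hn))))))).congr
      fun _ => rfl
  have hpt := sl_code hvoff hn ((RunCtx.r_code.comp hc).congr fun _ => rfl)
  have hpred : CodeFP e₂ bitE (fun s => predN dR (candC s.1) (sl s.1.1.1.1.2 (min (lvlCoffP s.1.1.1.1.1.1 s.1.1.1.1.1.2.1 s.1.1.1.1.1.2.2 (min s.1.1.2 s.1.1.1.1.2.length) +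
      RepsP s.1.1.1.1.1.1 s.1.1.1.1.1.2.1 s.1.1.1.1.1.2.2 (min s.1.1.2 s.1.1.1.1.2.length) * lvlSlotP s.1.1.1.1.1.1 s.1.1.1.1.1.2.1 s.1.1.1.1.1.2.2 (min s.1.1.2 s.1.1.1.1.2.length) +
      s.2 * s.1.1.1.1.1.1) s.1.1.1.1.2.length) s.1.1.1.1.1.1)) := ((predN_code hdR).comp ((cand_code.comp hc).pair hpt)).congr fun _ => rfl
  have hvans : CodeFP e₂ bitE (fun s => s.1.1.1.2.getD (qoffP s.1.1.1.1.1.1 s.1.1.1.1.1.2.1 s.1.1.1.1.1.2.2 (min s.1.1.2 s.1.1.1.1.2.length) +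
      RepsP s.1.1.1.1.1.1 s.1.1.1.1.1.2.1 s.1.1.1.1.1.2.2 (min s.1.1.2 s.1.1.1.1.2.length) * nQRunP s.1.1.1.1.1.1 s.1.1.1.1.1.2.1 s.1.1.1.1.1.2.2 (min s.1.1.2 s.1.1.1.1.2.length) +
      s.2) false) :=
    (strGetDNat.comp (((RunCtx.ans_code.comp hc).congr fun _ => rfl).pair (natAdd.comp ((natAdd.comp (hqoff.pair (natMul.comp (hReps.pair hnq)))).pair hw)))).congr
      fun _ => rfl
  have hneq := hpred.ite hvans.not hvans
  have hMU : CodeFP runCtxE unE (fun c => min (MP c.1.1.1.1.1 c.1.1.1.1.2.1 c.1.1.1.1.2.2 (min c.1.2 c.1.1.1.2.length)) c.1.1.1.2.length) :=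
    (unOfNatMin.comp (RunCtx.R_code.pair ((LvlArg.M_code.comp RunCtx.x_code).congr fun _ => rfl))).congr fun _ => rfl
  refine (((ulength natE).comp ((filter hneq).comp ((CodeFP.id _).pair (urange.comp hMU)))).congr fun c => ?_)
  simp only [errsC, errsN, valPtC, valAnsN, id, bne_eq_ite, candC]

include hdR in
/-- **The test is a code** on the run context. [folklore] -/
theorem passes_code : CodeFP runCtxE bitE (passesC dR) := by
  have hM : CodeFP runCtxE natE (fun c => MP c.1.1.1.1.1 c.1.1.1.1.2.1 c.1.1.1.1.2.2 (min c.1.2 c.1.1.1.2.length)) := (LvlArg.M_code.comp RunCtx.x_code).congr fun _ => rfl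
  exact (natLe.comp ((natMul.comp ((natMul.comp ((const _ 4).pair (natOfUn.comp RunCtx.a_code))).pair (natOfUn.comp (errs_code hdR)))).pair
    (natMul.comp ((const _ 3).pair hM)))).congr fun c => by simp only [passesC, passesN, errsC, id]; exact decide_eq_decide.mpr Iff.rfl

omit P in
/-- `isEmptyB` is a code. [folklore] -/
theorem isEmptyB_code : CodeFP (rawE natE) bitE isEmptyB :=
  (natEq.comp ((natOfUn.comp (ulength natE)).pair (const _ 0))).congr fun _ => decide_eq_decide.mpr Iff.rfl

/-- On a level `ℓ ≤ |r|` the capped selection is the selection. [folklore] -/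
theorem levelSelC_eq (dR : List Bool → List Bool) (g : GInT) {ℓ : ℕ} (hℓ : ℓ ≤ g.1.2.length) :
    levelSelC dR (g, ℓ) = levelSelN dR g.1.1.1 g.1.1.2.1 g.1.1.2.2 g.1.2 g.2 ℓ := by
  rw [levelSelC, min_eq_left hℓ]

include hdR in
/-- **The level selection is a code** on the level context. [folklore] -/
theorem levelSel_code : CodeFP (pairE gInE natE) strE (levelSelC dR) := by
  let e₁ := pairE gInE natE
  have hg : CodeFP e₁ gInE (fun y => y.1) := fst _ _
  have hr : CodeFP e₁ strE (fun y => y.1.1.2) := hg.fst'.snd'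
  have hR : CodeFP e₁ unE (fun y => y.1.1.2.length) := (strLength.comp hr).congr fun _ => rfl
  have hℓ : CodeFP e₁ unE (fun y => min y.2 y.1.1.2.length) := (unOfNatMin.comp (hR.pair (snd _ _))).congr fun _ => rfl
  have hx : CodeFP e₁ lvlArgE (fun y => (y.1.1.1, min y.2 y.1.1.2.length)) := (hg.fst'.fst'.pair hℓ).congr fun _ => rfl
  have hx1 : CodeFP e₁ lvlArgE (fun y => (y.1.1.1, min y.2 y.1.1.2.length + 1)) := (hg.fst'.fst'.pair ((unAdd.comp (hℓ.pair (const _ 1))).congr fun _ => rfl)).congr fun _ => rfl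
  have hproc : CodeFP e₁ bitE (fun y => decide (lvlCoffP y.1.1.1.1 y.1.1.1.2.1 y.1.1.1.2.2 (min y.2 y.1.1.2.length + 1) ≤ y.1.1.2.length)) :=
    (natLe.comp (((coff_code.comp hx1).congr fun _ => rfl).pair (natOfUn.comp hR))).congr fun _ => rfl
  -- the passing runs
  have hRepsU : CodeFP e₁ unE (fun y => min (RepsP y.1.1.1.1 y.1.1.1.2.1 y.1.1.1.2.2 (min y.2 y.1.1.2.length)) y.1.1.2.length) :=
    (unOfNatMin.comp (hR.pair ((LvlArg.Reps_code.comp hx).congr fun _ => rfl))).congr fun _ => rfl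
  have hpassItem : CodeFP (pairE e₁ natE) bitE (fun s => passesC dR (s.1, s.2)) := ((passes_code hdR).comp ((fst _ _).pair (snd _ _))).congr fun _ => rfl
  have hpassing : CodeFP e₁ (rawE natE) (fun y => (List.range (min (RepsP y.1.1.1.1 y.1.1.1.2.1 y.1.1.1.2.2 (min y.2 y.1.1.2.length)) y.1.1.2.length)).filter
      fun ρ => passesC dR (y, ρ)) := ((filter hpassItem).comp ((CodeFP.id _).pair (urange.comp hRepsU))).congr fun _ => by simp only [id]
  have hempty : CodeFP e₁ bitE (fun y => isEmptyB ((List.range (min (RepsP y.1.1.1.1 y.1.1.1.2.1 y.1.1.1.2.2 (min y.2 y.1.1.2.length)) y.1.1.2.length)).filter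
      fun ρ => passesC dR (y, ρ))) := (isEmptyB_code.comp hpassing).congr fun _ => rfl
  have hhead : CodeFP e₁ natE (fun y => (((List.range (min (RepsP y.1.1.1.1 y.1.1.1.2.1 y.1.1.1.2.2 (min y.2 y.1.1.2.length)) y.1.1.2.length)).filter
      fun ρ => passesC dR (y, ρ)).headD 0)) := ((rawHeadOr natE).comp ((const _ (0 : ℕ)).pair hpassing)).congr fun _ => by with_reducible rfl
  have hcand : CodeFP e₁ strE (fun y => candC (y, (((List.range (min (RepsP y.1.1.1.1 y.1.1.1.2.1 y.1.1.1.2.2 (min y.2 y.1.1.2.length)) y.1.1.2.length)).filter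
      fun ρ => passesC dR (y, ρ)).headD 0))) := (cand_code.comp ((CodeFP.id _).pair hhead)).congr fun _ => by simp only [id]
  refine ((hproc.ite (hempty.ite (const _ ([] : List Bool)) hcand) (const _ ([] : List Bool))).congr fun y => ?_)
  unfold levelSelC levelSelN passingN passesC candC
  with_reducible rfl

/-- The capped output on the `G`-input. [folklore] -/
noncomputable def gOutC (dR : List Bool → List Bool) (g : GInT) : List Bool := gOutN dR g.1.1.1 g.1.1.2.1 g.1.1.2.2 g.1.2 g.2

include hdR in
/-- **The output is a code.** [cite: CarmosinoImpagliazzoKabanetsKolokolova2016, Thm. 5.1 (running time)] -/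
theorem gOut_code : CodeFP gInE strE (gOutC dR) := by
  have hR : CodeFP gInE unE (fun g => g.1.2.length) := (strLength.comp (fst _ _).snd').congr fun _ => rfl
  have hitem : CodeFP (pairE gInE natE) bitE (fun y => !decide ((levelSelC dR (y.1, y.2)).length ≤ 0)) :=
    ((natLe.comp ((natOfUn.comp (strLength.comp ((levelSel_code hdR).comp ((fst _ _).pair (snd _ _))))).pair (const _ 0))).not).congr fun _ => rfl
  have hgood : CodeFP gInE (rawE natE) (fun g => (List.range (g.1.2.length + 1)).filter fun ℓ => !decide ((levelSelC dR (g, ℓ)).length ≤ 0)) :=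
    ((filter hitem).comp ((CodeFP.id _).pair (urange.comp ((unAdd.comp (hR.pair (const _ 1))).congr fun _ => rfl)))).congr fun _ => by
      simp only [id]; try rfl
  have hempty : CodeFP gInE bitE (fun g => isEmptyB ((List.range (g.1.2.length + 1)).filter fun ℓ => !decide ((levelSelC dR (g, ℓ)).length ≤ 0))) :=
    (isEmptyB_code.comp hgood).congr fun _ => rfl
  have hhead : CodeFP gInE natE (fun g => ((List.range (g.1.2.length + 1)).filter fun ℓ => !decide ((levelSelC dR (g, ℓ)).length ≤ 0)).headD 0) :=
    ((rawHeadOr natE).comp ((const _ 0).pair hgood)).congr fun _ => rfl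
  have hsel : CodeFP gInE strE (fun g => levelSelC dR (g, ((List.range (g.1.2.length + 1)).filter fun ℓ => !decide ((levelSelC dR (g, ℓ)).length ≤ 0)).headD 0)) :=
    ((levelSel_code hdR).comp ((CodeFP.id _).pair hhead)).congr fun _ => by simp only [id]
  refine ((hempty.ite (const _ ([] : List Bool)) hsel).congr fun g => ?_)
  -- the listed levels are `≤ |r|`, so the caps are inactive
  have hgl : ((List.range (g.1.2.length + 1)).filter fun ℓ => !decide ((levelSelC dR (g, ℓ)).length ≤ 0)) = goodLvlsN dR g.1.1.1 g.1.1.2.1 g.1.1.2.2 g.1.2 g.2 := by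
    rw [goodLvlsN]
    exact List.filter_congr fun ℓ hℓ => by rw [levelSelC_eq dR g (Nat.lt_succ_iff.1 (List.mem_range.1 hℓ))]
  have hmem : ∀ {L : List ℕ}, L = goodLvlsN dR g.1.1.1 g.1.1.2.1 g.1.1.2.2 g.1.2 g.2 → L.length ≠ 0 → L.headD 0 ≤ g.1.2.length := by
    rintro L rfl hne
    have h0 : (goodLvlsN dR g.1.1.1 g.1.1.2.1 g.1.1.2.2 g.1.2 g.2).headD 0 ∈ goodLvlsN dR g.1.1.1 g.1.1.2.1 g.1.1.2.2 g.1.2 g.2 := by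
      cases hL : goodLvlsN dR g.1.1.1 g.1.1.2.1 g.1.1.2.2 g.1.2 g.2 with
      | nil => rw [hL] at hne; exact absurd rfl hne
      | cons x xs => simp
    rw [goodLvlsN] at h0
    exact Nat.lt_succ_iff.1 (List.mem_range.1 (List.mem_filter.1 h0).1)
  simp only [gOutC, gOutN, hgl]
  by_cases h : (goodLvlsN dR g.1.1.1 g.1.1.2.1 g.1.1.2.2 g.1.2 g.2).length = 0
  · simp [h, isEmptyB]
  · rw [isEmptyB, if_neg (by simpa using h), if_neg (by simpa using h), levelSelC_eq dR g (hmem rfl h)]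

/-- **The output function of the `AC⁰[p]` learner.** [cite: CarmosinoImpagliazzoKabanetsKolokolova2016, §5 (complete algorithm)] -/
noncomputable def gPFn (dR : List Bool → List Bool) : List Bool → List Bool := by
  classical
  exact if h : dR ∈ FP then Classical.choose (gOut_code h) else fun _ => []

include hdR in
/-- `gPFn dR ∈ FP` for `dR ∈ FP`. [cite: CarmosinoImpagliazzoKabanetsKolokolova2016, Thm. 5.1 (running time)] -/
theorem gPFn_mem_FP : gPFn dR ∈ FP := by
  unfold gPFn
  rw [dif_pos hdR]
  exact (Classical.choose_spec (gOut_code hdR)).1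

include hdR in
/-- **Value of `gPFn`**: the typed output recipe. [folklore] -/
theorem gPFn_apply (n a b : ℕ) (r ans : List Bool) : gPFn dR (boolPair (boolPair (pacParams n a b) r) ans) = gOutN dR n a b r ans := by
  have h := (Classical.choose_spec (gOut_code hdR)).2 (((n, (a, b)), r), ans)
  unfold gPFn
  rw [dif_pos hdR, pacParams_eq, show boolPair (lrnInE ((n, (a, b)), r)) ans = gInE (((n, (a, b)), r), ans) from rfl, h]
  rfl

end Code2

end Modp

end Literature.Computability.Learning


/-!
## Part — The `AC⁰[p]` learner and its evaluator as oracle machines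

Machine-layer groundwork for the named fact `Literature.Computability.Learning.cikk_learn_AC0Mod`
(CIKK 2016, Cor. 5.4): the learner `cikkLearnerP dR = ttFnAlg qPFn qP (gPFn dR)` (a truth-table
transducer asking the `qP(|x|) = 2|x|` scheduled membership queries and outputting the first
validated candidate) and the evaluator `cikkEvalP dR` (query-free, the first bit of
`EvalPFP.evalPFn dR`); both polynomial-time for `dR ∈ FP`; the closed forms of the PAC run
(`runIdx_cikkLearnerP`: the output is `gOutN dR n a b r (ansListP n a b r f (2|x|))`) and of the
evaluated hypothesis (`evalHyp_cikkEvalP`: it is `SelectP.hypOfP`).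

## References

* M. Carmosino, R. Impagliazzo, V. Kabanets, A. Kolokolova, *Learning algorithms from natural
  proofs*, CCC 2016, §5 and Thm. 5.1 [CarmosinoImpagliazzoKabanetsKolokolova2016].
-/

open Polynomial

namespace Literature.Computability.Learning

namespace Modp

open Literature.Computability.Complexity Literature.Computability.Complexity.Brick
  Literature.Computability.Complexity.Plumb Literature.Computability.MetaComplexity
  Literature.Computability.Cryptography _root_.Computability Finset

variable [P : PrimeP]

/-! ### The number of queries -/

section Total

/-- **The round polynomial** `qP = 2X`. [folklore] -/
noncomputable def qP : Polynomial ℕ := 2 * X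

variable (n a b : ℕ) (r : List Bool)

/-- The queries of a level are at most twice its block. [folklore] -/
theorem lvlNQP_le (ℓ : ℕ) : lvlNQP n a b ℓ ≤ 2 * lvlBlockLenP n a b ℓ := by
  have hM := MP_le_RepsP n a b ℓ
  have h1 : RepsP n a b ℓ * nQRunP n a b ℓ ≤ RepsP n a b ℓ * lvlSlotP n a b ℓ := Nat.mul_le_mul_left _ (Nat.le_add_left _ _)
  have h2 : RepsP n a b ℓ ≤ RepsP n a b ℓ * lvlSlotP n a b ℓ :=
    Nat.le_mul_of_pos_right _ (by have := kP_pos n a b ℓ; unfold lvlSlotP nQRunP; omega)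
  unfold lvlNQP lvlBlockLenP; omega

/-- **The total number of queries is at most `2|r|`.** [folklore] -/
theorem totalNQP_le : totalNQP n a b r ≤ 2 * r.length := by
  rw [totalNQP, qoffP]
  -- the processed levels' blocks fit into `r`
  have hproc : lvlCoffP n a b (nLvlsP n a b r.length) ≤ r.length := by
    rcases Nat.eq_zero_or_pos (nLvlsP n a b r.length) with h | h
    · rw [h]; simp [lvlCoffP]
    · have hlast : LvlProcessedP n a b r.length (nLvlsP n a b r.length - 1) := (processed_iff_lt_nLvlsP n a b r.length _).2 (by omega)
      have := hlast; unfold LvlProcessedP at this; rwa [Nat.sub_add_cancel h] at this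
  calc ∑ ℓ' ∈ Finset.range (nLvlsP n a b r.length), lvlNQP n a b ℓ' ≤ ∑ ℓ' ∈ Finset.range (nLvlsP n a b r.length), 2 * lvlBlockLenP n a b ℓ' :=
        Finset.sum_le_sum fun ℓ' _ => lvlNQP_le n a b ℓ'
    _ = 2 * lvlCoffP n a b (nLvlsP n a b r.length) := by rw [lvlCoffP, Finset.mul_sum]
    _ ≤ 2 * r.length := Nat.mul_le_mul_left _ hproc

/-- The total number of queries is within the round polynomial. [folklore] -/
theorem totalNQP_le_qP : totalNQP n a b r ≤ qP.eval (boolPair (pacParams n a b) r).length := by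
  rw [qP, eval_mul, eval_ofNat, eval_X, length_boolPair]
  have := totalNQP_le n a b r
  omega

end Total

/-! ### The machines -/

section Machines

variable (dR : List Bool → List Bool)

/-- **The `AC⁰[p]` learner** as an oracle machine. [cite: CarmosinoImpagliazzoKabanetsKolokolova2016, §5 (complete algorithm), Cor. 5.4] -/
noncomputable def cikkLearnerP : OracleAlg (List Bool) := ttFnAlg qPFn qP (gPFn dR)

/-- The language decided by the evaluator: the strings `⟨w, x⟩` with hypothesis bit `1`. [folklore] -/
def EvalLangP : Language Bool := {s | (evalPFn dR s).getD 0 false = true}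

/-- **The evaluator** as a query-free oracle machine. [cite: CarmosinoImpagliazzoKabanetsKolokolova2016, §5] -/
noncomputable def cikkEvalP : OracleAlg Bool := OracleAlg.ofFun (EvalLangP dR).boolIndicator

variable {dR}

/-- The indicator of `EvalLangP` is the first bit of `evalPFn`. [folklore] -/
theorem evalLangP_boolIndicator (s : List Bool) : (EvalLangP dR).boolIndicator s = (evalPFn dR s).getD 0 false := by
  by_cases h : (evalPFn dR s).getD 0 false = true
  · rw [(Set.mem_iff_boolIndicator _ _).1 (show s ∈ EvalLangP dR from h), h]
  · rw [Bool.not_eq_true] at h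
    have hns : s ∉ EvalLangP dR := fun hs => by
      have hs' : (evalPFn dR s).getD 0 false = true := hs
      rw [h] at hs'
      exact Bool.false_ne_true hs'
    rw [(Set.notMem_iff_boolIndicator _ _).1 hns, h]

omit P in
/-- The first bit with default is the head with default. [folklore] -/
theorem getD_zero_eq_headD (l : List Bool) : l.getD 0 false = l.headD false := by cases l <;> rfl

/-- `EvalLangP dR ∈ P` for `dR ∈ FP`. [cite: CarmosinoImpagliazzoKabanetsKolokolova2016, Thm. 5.1 (running time)] -/
theorem evalLangP_mem_P (hdR : dR ∈ FP) : EvalLangP dR ∈ Classes.P := by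
  refine mem_P_of_mem_FP (comp_mem_FP HashBricks.headBitFn_mem_FP (evalPFn_mem_FP hdR)) (EvalLangP dR) fun s => ⟨fun hs => ?_, fun hs => ?_⟩
  · rw [Function.comp_apply, HashBricks.headBitFn_apply, ← getD_zero_eq_headD, show (evalPFn dR s).getD 0 false = true from hs]
  · rw [Function.comp_apply, HashBricks.headBitFn_apply, ← getD_zero_eq_headD]
    have : (evalPFn dR s).getD 0 false = false := by
      cases h : (evalPFn dR s).getD 0 false
      · rfl
      · exact absurd h hs
    rw [this]

/-- **The learner is polynomial-time** (for `dR ∈ FP`). [cite: CarmosinoImpagliazzoKabanetsKolokolova2016, Thm. 5.1, Cor. 5.4] -/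
theorem isPolyTime_cikkLearnerP (hdR : dR ∈ FP) : (cikkLearnerP dR).IsPolyTime (encodingList Bool) :=
  isPolyTime_ttFnAlg qPFn_mem_FP (gPFn_mem_FP hdR)

/-- **The evaluator is polynomial-time** (for `dR ∈ FP`). [cite: CarmosinoImpagliazzoKabanetsKolokolova2016, Thm. 5.1] -/
theorem isPolyTime_cikkEvalP (hdR : dR ∈ FP) : (cikkEvalP dR).IsPolyTime encodingBoolBool :=
  OracleAlg.isPolyTime_ofFun_holds (polyTimeDecidable_iff.1 (mem_P_iff_holds.1 (evalLangP_mem_P hdR)))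

/-- **The evaluated hypothesis of a string `w`** is the first bit of `evalPFn dR ⟨w, x⟩`. [folklore] -/
theorem evalHyp_cikkEvalP {m : ℕ} (w : List Bool) (x : Fin m → Bool) :
    evalHyp (cikkEvalP dR) 1 w x = (evalPFn dR (boolPair w (List.ofFn x))).getD 0 false := by
  rw [evalHyp, cikkEvalP, OracleAlg.run_ofFun_succ, Option.getD_some, evalLangP_boolIndicator]

/-- **The evaluated hypothesis of a candidate is `hypOfP`.** [folklore] -/
theorem evalHyp_cikkEvalP_candN (n a b : ℕ) (r ans : List Bool) (ℓ ρ : ℕ) :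
    evalHyp (cikkEvalP dR) 1 (candN n a b r ans ℓ ρ) = hypOfP dR n a b r ans ℓ ρ := by
  funext x
  rw [evalHyp_cikkEvalP, hypOfP, predN]

/-- **The PAC run of the learner**: against `pacOracle true f xs` (membership queries only), within
any budget `T > 2|x|`, on `x = ⟨pacParams n a b, r⟩`, the learner outputs
`gOutN dR n a b r (ansListP n a b r f (2|x|))`. [cite: CarmosinoImpagliazzoKabanetsKolokolova2016, §5, Thm. 5.1] -/
theorem runIdx_cikkLearnerP {n : ℕ} (a b : ℕ) (r : List Bool) (f : (Fin n → Bool) → Bool) (xs : List (Fin n → Bool)) {T : ℕ}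
    (hT : qP.eval (boolPair (pacParams n a b) r).length < T) :
    (cikkLearnerP dR).runIdx (pacOracle true f xs) T (boolPair (pacParams n a b) r) =
      some (gPFn dR (boolPair (boolPair (pacParams n a b) r) (ansListP n a b r f (qP.eval (boolPair (pacParams n a b) r).length)))) := by
  rw [cikkLearnerP, runIdx_ttFnAlg_mq f xs (boolPair (pacParams n a b) r) (fun i => rdBits (queryAtN n a b r i) 0 n)
    (fun i _ => by rw [qPFn_apply, ofFn_rdBits_of_length (length_queryAtN n a b r i)]) hT]
  rfl

end Machines

end Modp

end Literature.Computability.Learning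


/-!
## Part — The success analysis of the `AC⁰[p]` learner (counting over the coins)

Analysis for the named fact `Literature.Computability.Learning.cikk_learn_AC0Mod` (CIKK 2016,
Cor. 5.4), mirroring `LearnerAnalysis.lean` for the learner `cikkLearnerP`. Fix `n, a, b`, the target
`f`, a decision procedure `dR` of the property `R` and a level `ℓg`; the coin length is
`coinLenP n a b ℓg = lvlCoffP n a b (ℓg + 1)` (exactly the levels `ℓ ≤ ℓg` are processed). For coins
`rv`:

* `GoodRunP ℓ ρ rv` (the hypothesis `hypOfP` of run `ρ` of level `ℓ` has error `≤ 2ⁿ/(2a)`),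
  `BadVP`, `SuccessP`; `successP_of` (a good run at `ℓg` and no misleading validation force success);
* **the closed form of a run on a written segment** (`predN_extList`: on `extList e` the evaluated
  candidate is `runHypP … e.1`), so good typed coins give good windows (`goodW_of_good`);
* `card_noGoodP_le` (independent windows), `card_goodWP_ge` (from `card_goodRunP_ge` through the
  fibres of `CoinsP`), `card_badVP_le` (Hoeffding on the validation sample), `card_not_successP_le`.

## References

* M. Carmosino, R. Impagliazzo, V. Kabanets, A. Kolokolova, *Learning algorithms from natural
  proofs*, CCC 2016, §5, Thm. 5.1, Cor. 5.4 [CarmosinoImpagliazzoKabanetsKolokolova2016].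
* W. Hoeffding, *Probability inequalities for sums of bounded random variables*, JASA 58 (1963), Thm. 1 [Hoeffding1963].
-/

namespace Literature.Computability.Learning

namespace Modp

open Literature.Computability.Complexity Literature.Computability.Complexity.DirectProduct Literature.Computability.Complexity.GaussRank
  Literature.Computability.MetaComplexity Literature.Computability.Cryptography _root_.Computability Finset CodeFP

variable [P : PrimeP]

-- the nested coin products exceed the default instance size bound
set_option synthInstance.maxSize 2048
set_option synthInstance.maxHeartbeats 400000

/-! ### The closed form of a run on a written segment -/

section ClosedForm

variable {n a b ℓ : ℕ} (R : CombinatorialProperty) {dR : List Bool → List Bool} (hdRFP : dR ∈ FP)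
  (hdR : ∀ y, dR y = encodeBool ((truthTableLanguage R).boolIndicator y)) (f : (Fin n → Bool) → Bool)

/-- The extended coins of level `ℓ`. [folklore] -/
abbrev ExtLvl (n a b ℓ : ℕ) : Type := ExtCoinsP (teP n a b ℓ) ℓ n (κP n a b ℓ) (βP n a b ℓ) (τP ℓ) (kkP n a b ℓ) (tP n a b ℓ)

/-- **The typed hypothesis of the run with typed coins `ω`** (the closed form `runHypP` at the
level's parameters). [cite: CarmosinoImpagliazzoKabanetsKolokolova2016, §5 with Thm. 4.8] -/
noncomputable def typedHyp (R : CombinatorialProperty) (n a b ℓ : ℕ) (f : (Fin n → Bool) → Bool)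
    (ω : RunCoinsP n 𝔭 (βP n a b ℓ) (2 ^ κP n a b ℓ) (2 ^ τP ℓ) (2 ^ ℓ) (𝔭 ^ teP n a b ℓ * 𝔭 ^ teP n a b ℓ) (kkP n a b ℓ) (tP n a b ℓ)) :
    (Fin n → Bool) → Bool :=
  runHypP (designP (teP_ne_zero n a b ℓ) _ ℓ (lvl_hn n a b ℓ)) (natTest R ℓ) f ((θNP n a b ℓ : ℝ) / θDP n a b ℓ) ω

include hdRFP hdR in
/-- **On a written segment the evaluated candidate is the typed hypothesis**:
`predN dR ⟨hypN π (extList e) (answers)⟩ x = runHypP … e.1 x`. [cite: CarmosinoImpagliazzoKabanetsKolokolova2016, §5, Thm. 5.1 (proof)] -/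
theorem predN_extList (e : ExtLvl n a b ℓ) (x : Fin n → Bool) :
    predN dR (hypOutE 𝔭 (hypN (prmLvl n a b ℓ) (extList e) (runAnsW n a b f ℓ (extList e)))) (List.ofFn x) = typedHyp R n a b ℓ f e.1 x := by
  have hB := jB_pos_lvl n a b ℓ
  have hω := coinsToRunP_extList hB e
  -- the hypothesis record
  have hrec := hypN_eq hB (extList e) (validSeg_extList hB e) (by rw [length_extList]) (θNP n a b ℓ) (θDP n a b ℓ) f
    (ans := runAnsW n a b f ℓ (extList e)) (fillerAnsW_eq f (extList e)) (dpAnsW_eq f (extList e))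
  rw [hω] at hrec
  -- the tables
  obtain ⟨hsl0, hslz⟩ := seg_slices (n := n) (a := a) (b := b) (ℓ := ℓ) (extList e)
  rw [hω] at hsl0 hslz
  have hans := answersOKP_runAnsW (n := n) (a := a) (b := b) f (ℓ := ℓ) (extList e)
  rw [hω] at hans
  rw [predN, show prmLvl n a b ℓ = prmOf (teP n a b ℓ) ℓ n (κP n a b ℓ) (βP n a b ℓ) (τP ℓ) (kkP n a b ℓ) (tP n a b ℓ) (θNP n a b ℓ) (θDP n a b ℓ)
    from rfl, hrec, hsl0, hslz]
  have hev := evalPFn_apply (k := 2 ^ κP n a b ℓ) (T := 2 ^ τP ℓ) (teP_ne_zero n a b ℓ) (lvl_hn n a b ℓ) (p_le_two_pow_βP n a b ℓ) R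
    hdRFP hdR (tablesN (𝔭 ^ teP n a b ℓ) ℓ n (2 ^ κP n a b ℓ) (βP n a b ℓ) (2 ^ τP ℓ) (2 ^ ℓ) (List.ofFn ((boolFunEquivFin ℓ).symm e.1.1.1.1.1.1))
      (List.ofFn e.1.1.1.1.1.2.1) (runAnsW n a b f ℓ (extList e))) f (θN := θNP n a b ℓ) (θDP_pos n a b ℓ) e.1 (fun j hji => tablesN_getD hans j hji) x
  rw [hev]
  rfl

end ClosedForm

/-! ### Setup: coins of the good level, good runs, success -/

section Setup

variable (n a b : ℕ)

/-- **The coin length for the level `ℓg`**: all blocks of the levels `≤ ℓg`. [folklore] -/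
def coinLenP (ℓg : ℕ) : ℕ := lvlCoffP n a b (ℓg + 1)

variable {n a b}

/-- The offsets grow by at least one per level. [folklore] -/
theorem lvlCoffP_lt_succ (ℓ : ℕ) : lvlCoffP n a b ℓ < lvlCoffP n a b (ℓ + 1) := by
  have := one_le_lvlBlockLenP n a b ℓ
  have h2 : lvlCoffP n a b (ℓ + 1) = lvlCoffP n a b ℓ + lvlBlockLenP n a b ℓ := by rw [lvlCoffP, Finset.sum_range_succ]; rfl
  omega

/-- **Exactly the levels `≤ ℓg` are processed.** [folklore] -/
theorem processedP_iff (ℓg ℓ : ℕ) : LvlProcessedP n a b (coinLenP n a b ℓg) ℓ ↔ ℓ ≤ ℓg := by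
  rw [LvlProcessedP, coinLenP]
  constructor
  · intro h
    by_contra hlt
    have : lvlCoffP n a b (ℓg + 1) < lvlCoffP n a b (ℓ + 1) :=
      lt_of_lt_of_le (lvlCoffP_lt_succ (ℓg + 1)) (lvlCoffP_mono n a b (by omega))
    omega
  · intro h; exact lvlCoffP_mono n a b (by omega)

/-- The coins as a list. [folklore] -/
abbrev coinsListP (n a b ℓg : ℕ) (rv : Fin (coinLenP n a b ℓg) → Bool) : List Bool := List.ofFn rv

/-- **The answers the learner receives** on coins `rv` (all its scheduled membership queries). [folklore] -/
noncomputable abbrev ansOfP (n a b : ℕ) (f : (Fin n → Bool) → Bool) (ℓg : ℕ) (rv : Fin (coinLenP n a b ℓg) → Bool) : List Bool :=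
  ansListP n a b (coinsListP n a b ℓg rv) f (qP.eval (boolPair (pacParams n a b) (coinsListP n a b ℓg rv)).length)

/-- The hypothesis of run `(ℓ, ρ)` on coins `rv`. [folklore] -/
noncomputable abbrev hypRv (dR : List Bool → List Bool) (n a b : ℕ) (f : (Fin n → Bool) → Bool) (ℓg : ℕ) (ℓ ρ : ℕ)
    (rv : Fin (coinLenP n a b ℓg) → Bool) : (Fin n → Bool) → Bool :=
  hypOfP dR n a b (coinsListP n a b ℓg rv) (ansOfP n a b f ℓg rv) ℓ ρ

/-- **A good run**: error `≤ 2ⁿ/(2a)`. [cite: CarmosinoImpagliazzoKabanetsKolokolova2016, Thm. 5.1 (proof)] -/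
def GoodRunP (dR : List Bool → List Bool) (n a b : ℕ) (f : (Fin n → Bool) → Bool) (ℓg : ℕ) (ℓ ρ : ℕ)
    (rv : Fin (coinLenP n a b ℓg) → Bool) : Prop :=
  2 * a * errCount n f (hypRv dR n a b f ℓg ℓ ρ rv) ≤ 2 ^ n

/-- The validation test of run `(ℓ, ρ)` passes. [folklore] -/
def PassesP (dR : List Bool → List Bool) (n a b : ℕ) (f : (Fin n → Bool) → Bool) (ℓg : ℕ) (ℓ ρ : ℕ)
    (rv : Fin (coinLenP n a b ℓg) → Bool) : Prop :=
  passesN dR n a b (coinsListP n a b ℓg rv) (ansOfP n a b f ℓg rv) ℓ ρ = true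

/-- **A misleading validation**: a bad candidate passes or a good one fails. [folklore] -/
def BadVP (dR : List Bool → List Bool) (n a b : ℕ) (f : (Fin n → Bool) → Bool) (ℓg : ℕ) (ℓ ρ : ℕ)
    (rv : Fin (coinLenP n a b ℓg) → Bool) : Prop :=
  (2 ^ n < a * errCount n f (hypRv dR n a b f ℓg ℓ ρ rv) ∧ PassesP dR n a b f ℓg ℓ ρ rv) ∨
    (GoodRunP dR n a b f ℓg ℓ ρ rv ∧ ¬ PassesP dR n a b f ℓg ℓ ρ rv)

/-- **Success**: the output is a candidate of error `≤ 2ⁿ/a`. [folklore] -/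
def SuccessP (dR : List Bool → List Bool) (n a b : ℕ) (f : (Fin n → Bool) → Bool) (ℓg : ℕ) (rv : Fin (coinLenP n a b ℓg) → Bool) : Prop :=
  ∃ ℓ ρ, gOutN dR n a b (coinsListP n a b ℓg rv) (ansOfP n a b f ℓg rv) = candN n a b (coinsListP n a b ℓg rv) (ansOfP n a b f ℓg rv) ℓ ρ ∧
    a * errCount n f (hypRv dR n a b f ℓg ℓ ρ rv) ≤ 2 ^ n

variable {dR : List Bool → List Bool} {f : (Fin n → Bool) → Bool} {ℓg : ℕ}

/-- The candidate strings are nonempty (the outer code is a pair). [folklore] -/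
theorem candN_ne_nil (r ans : List Bool) (ℓ ρ : ℕ) : candN n a b r ans ℓ ρ ≠ [] := by
  intro h
  have := congrArg List.length h
  rw [candN, hypOutE, pairE_apply, length_boolPair] at this
  simp at this

/-- **The logic of the selection**: a good run at level `ℓg` and no misleading validation force success.
[cite: CarmosinoImpagliazzoKabanetsKolokolova2016, §5 (complete algorithm, step 6)] -/
theorem successP_of (rv : Fin (coinLenP n a b ℓg) → Bool) (hgood : ∃ ρ < RepsP n a b ℓg, GoodRunP dR n a b f ℓg ℓg ρ rv)
    (hval : ∀ ℓ ≤ ℓg, ∀ ρ < RepsP n a b ℓ, ¬ BadVP dR n a b f ℓg ℓ ρ rv) : SuccessP dR n a b f ℓg rv := by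
  classical
  set r := coinsListP n a b ℓg rv with hr
  set ans := ansOfP n a b f ℓg rv with hans
  have hlen : r.length = coinLenP n a b ℓg := List.length_ofFn
  -- the good level has a passing run
  obtain ⟨ρ₀, hρ₀, hg₀⟩ := hgood
  have hpass₀ : passesN dR n a b r ans ℓg ρ₀ = true := by
    by_contra hnp; exact hval ℓg le_rfl ρ₀ hρ₀ (Or.inr ⟨hg₀, hnp⟩)
  have hproc : LvlProcessedP n a b r.length ℓg := by rw [hlen]; exact (processedP_iff ℓg ℓg).2 le_rfl
  have hne : levelSelN dR n a b r ans ℓg ≠ [] := by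
    rw [levelSelN, if_pos (by simpa [LvlProcessedP] using hproc), passingN_eq hproc]
    have hmem : ρ₀ ∈ (List.range (RepsP n a b ℓg)).filter (passesN dR n a b r ans ℓg) := List.mem_filter.2 ⟨List.mem_range.2 hρ₀, hpass₀⟩
    rw [isEmptyB]
    cases hq : (List.range (RepsP n a b ℓg)).filter (passesN dR n a b r ans ℓg) with
    | nil => rw [hq] at hmem; exact absurd hmem (by simp)
    | cons x xs => simp only [List.length_cons]; rw [if_neg (by simp)]; exact candN_ne_nil _ _ _ _
  -- so the global search finds a level
  have hℓgC : ℓg < r.length + 1 := by have := lt_of_processed n a b hproc; omega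
  have hmemG : ℓg ∈ goodLvlsN dR n a b r ans := List.mem_filter.2 ⟨List.mem_range.2 hℓgC, by simpa using hne⟩
  cases hq : goodLvlsN dR n a b r ans with
  | nil => rw [hq] at hmemG; exact absurd hmemG (by simp)
  | cons ℓ₁ rest =>
    have hℓ₁mem : ℓ₁ ∈ goodLvlsN dR n a b r ans := by rw [hq]; simp
    have hℓ₁ : levelSelN dR n a b r ans ℓ₁ ≠ [] := by
      have := (List.mem_filter.1 hℓ₁mem).2
      simpa using this
    have hproc₁ : LvlProcessedP n a b r.length ℓ₁ := by
      by_contra hnp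
      apply hℓ₁
      rw [levelSelN, if_neg (by simpa [LvlProcessedP] using hnp)]
    have hle₁ : ℓ₁ ≤ ℓg := (processedP_iff ℓg ℓ₁).1 (by rwa [hlen] at hproc₁)
    have hsel : levelSelN dR n a b r ans ℓ₁ = (if isEmptyB ((List.range (RepsP n a b ℓ₁)).filter (passesN dR n a b r ans ℓ₁)) then []
        else candN n a b r ans ℓ₁ (((List.range (RepsP n a b ℓ₁)).filter (passesN dR n a b r ans ℓ₁)).headD 0)) := by
      rw [levelSelN, if_pos (by simpa [LvlProcessedP] using hproc₁), passingN_eq hproc₁]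
    cases hq₁ : (List.range (RepsP n a b ℓ₁)).filter (passesN dR n a b r ans ℓ₁) with
    | nil => rw [hsel, hq₁, isEmptyB] at hℓ₁; simp at hℓ₁
    | cons ρ₁ rest₁ =>
      have hρ₁mem : ρ₁ ∈ (List.range (RepsP n a b ℓ₁)).filter (passesN dR n a b r ans ℓ₁) := by rw [hq₁]; simp
      have hpass₁ := (List.mem_filter.1 hρ₁mem).2
      have hρ₁ : ρ₁ < RepsP n a b ℓ₁ := List.mem_range.1 (List.mem_filter.1 hρ₁mem).1
      refine ⟨ℓ₁, ρ₁, ?_, ?_⟩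
      · rw [gOutN, hq, isEmptyB]
        simp only [List.length_cons, List.headD_cons]
        rw [if_neg (by simp), hsel, hq₁, isEmptyB]
        simp only [List.length_cons, List.headD_cons]
        rw [if_neg (by simp)]
      · have := hval ℓ₁ hle₁ ρ₁ hρ₁
        rw [BadVP, not_or, not_and] at this
        exact not_lt.1 fun hlt => this.1 hlt hpass₁

end Setup

/-! ### Windows of the coins: run segments -/

section WindowFacts

variable {n a b : ℕ} {dR : List Bool → List Bool} {f : (Fin n → Bool) → Bool} {ℓg : ℕ}

/-- The run segment `(ℓ, ρ)` fits into the coins (`ℓ ≤ ℓg`, `ρ < Reps`). [folklore] -/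
theorem segWindowP_le {ℓ : ℕ} (hℓ : ℓ ≤ ℓg) {ρ : ℕ} (hρ : ρ < RepsP n a b ℓ) :
    lvlCoffP n a b ℓ + ρ * lvlSlotP n a b ℓ + lvlRunLenP n a b ℓ ≤ coinLenP n a b ℓg := by
  have := slot_fits n a b (R := coinLenP n a b ℓg) ((processedP_iff ℓg ℓ).2 hℓ) hρ
  unfold lvlSlotP at this ⊢; omega

/-- Enough queries are answered for run `(ℓ, ρ)` (`ℓ ≤ ℓg`). [folklore] -/
theorem queries_suffice {ℓ : ℕ} (hℓ : ℓ ≤ ℓg) (rv : Fin (coinLenP n a b ℓg) → Bool) :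
    qoffP n a b ℓ + lvlNQP n a b ℓ ≤ qP.eval (boolPair (pacParams n a b) (coinsListP n a b ℓg rv)).length := by
  refine le_trans ?_ (totalNQP_le_qP n a b _)
  rw [totalNQP, List.length_ofFn]
  have hlt : ℓ < nLvlsP n a b (coinLenP n a b ℓg) := (processed_iff_lt_nLvlsP n a b _ ℓ).1 ((processedP_iff ℓg ℓ).2 hℓ)
  rw [qoffP, qoffP, ← Finset.sum_range_succ]
  exact Finset.sum_le_sum_of_subset (Finset.range_mono hlt)

/-- **The hypothesis of a window assignment**: the evaluator on the candidate built from the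
window's bits and the answers to the window's queries. [folklore] -/
noncomputable def hypW (dR : List Bool → List Bool) (n a b : ℕ) (f : (Fin n → Bool) → Bool) (ℓ : ℕ) (w : Fin (lvlRunLenP n a b ℓ) → Bool) :
    (Fin n → Bool) → Bool :=
  fun x => predN dR (hypOutE 𝔭 (hypN (prmLvl n a b ℓ) (List.ofFn w) (runAnsW n a b f ℓ (List.ofFn w)))) (List.ofFn x)

omit P in
/-- A slice of `List.ofFn` is the `ofFn` of the window. [folklore] -/
theorem sl_ofFn_window {C o len : ℕ} (h : o + len ≤ C) (rv : Fin C → Bool) : sl (List.ofFn rv) o len = List.ofFn (windowRead h rv) := by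
  rw [sl_eq_ofFn _ (by simpa using h)]
  refine congrArg List.ofFn (funext fun i => ?_)
  rw [rdBits, List.getD_eq_getElem _ _ (by simp; omega), List.getElem_ofFn, windowRead]

/-- **The hypothesis of run `(ℓ, ρ)` depends only on its window.** [folklore] -/
theorem hypRv_eq_hypW {ℓ : ℕ} (hℓ : ℓ ≤ ℓg) {ρ : ℕ} (hρ : ρ < RepsP n a b ℓ) (rv : Fin (coinLenP n a b ℓg) → Bool) :
    hypRv dR n a b f ℓg ℓ ρ rv = hypW dR n a b f ℓ (windowRead (segWindowP_le hℓ hρ) rv) := by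
  have hproc : LvlProcessedP n a b (coinsListP n a b ℓg rv).length ℓ := by rw [List.length_ofFn]; exact (processedP_iff ℓg ℓ).2 hℓ
  funext x
  rw [hypRv, hypOfP, hypW, candN_eq hproc, runAnsN_eq_runAnsW f hproc hρ
    (by have := queries_suffice (n := n) (a := a) (b := b) hℓ rv; unfold lvlNQP at this; omega), lvlSegP, sl_ofFn_window (segWindowP_le hℓ hρ)]

end WindowFacts

open scoped Classical

/-! ### No good run at level `ℓg`: independent windows -/

section NoGood

variable (dR : List Bool → List Bool) (n a b : ℕ) (f : (Fin n → Bool) → Bool) (ℓg : ℕ)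

/-- No run `ρ < m` of level `ℓg` is good. [folklore] -/
def NoGoodBelowP (m : ℕ) (rv : Fin (coinLenP n a b ℓg) → Bool) : Prop := ∀ ρ < m, ¬ GoodRunP dR n a b f ℓg ℓg ρ rv

/-- A good window assignment of a run of level `ℓg`. [folklore] -/
def GoodWP (w : Fin (lvlRunLenP n a b ℓg) → Bool) : Prop := 2 * a * errCount n f (hypW dR n a b f ℓg w) ≤ 2 ^ n

variable {dR n a b f ℓg}

/-- `GoodRunP` at level `ℓg` is `GoodWP` of the window. [folklore] -/
theorem goodRunP_iff {ρ : ℕ} (hρ : ρ < RepsP n a b ℓg) (rv : Fin (coinLenP n a b ℓg) → Bool) :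
    GoodRunP dR n a b f ℓg ℓg ρ rv ↔ GoodWP dR n a b f ℓg (windowRead (segWindowP_le le_rfl hρ) rv) := by
  rw [GoodRunP, GoodWP, hypRv_eq_hypW le_rfl hρ]

/-- **The product identity**: `#{NoGoodBelow m} · (2^{RL})^m = 2^{coinLen} · #{¬GoodW}^m`.
[cite: CarmosinoImpagliazzoKabanetsKolokolova2016, Thm. 5.1 (proof: independent repetitions)] -/
theorem card_noGoodBelowP_mul : ∀ m : ℕ, m ≤ RepsP n a b ℓg →
    (univ.filter (NoGoodBelowP dR n a b f ℓg m)).card * (2 ^ lvlRunLenP n a b ℓg) ^ m =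
      2 ^ coinLenP n a b ℓg * (univ.filter fun w => ¬ GoodWP dR n a b f ℓg w).card ^ m
  | 0, _ => by
    rw [pow_zero, mul_one, pow_zero, mul_one,
      Finset.filter_true_of_mem (s := univ) (p := NoGoodBelowP dR n a b f ℓg 0) (fun rv _ => fun ρ h => absurd h (Nat.not_lt_zero _)),
      Finset.card_univ, Fintype.card_fun, Fintype.card_fin, Fintype.card_bool]
  | m + 1, hm => by
    have hρ : m < RepsP n a b ℓg := hm
    have hwin := segWindowP_le (n := n) (a := a) (b := b) (le_refl ℓg) hρ
    have hsplit : (univ.filter (NoGoodBelowP dR n a b f ℓg (m + 1))) =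
        univ.filter fun rv => NoGoodBelowP dR n a b f ℓg m rv ∧ ¬ GoodWP dR n a b f ℓg (windowRead hwin rv) := by
      refine Finset.filter_congr fun rv _ => ?_
      rw [NoGoodBelowP, NoGoodBelowP]
      constructor
      · intro h; exact ⟨fun ρ hρ' => h ρ (by omega), fun hg => h m (Nat.lt_succ_self m) ((goodRunP_iff hρ rv).2 hg)⟩
      · rintro ⟨h1, h2⟩ ρ hρ'
        rcases Nat.lt_succ_iff_lt_or_eq.1 hρ' with hlt | heq
        · exact h1 ρ hlt
        · rw [heq]; exact fun hg => h2 ((goodRunP_iff hρ rv).1 hg)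
    have hind : ∀ rest w w', NoGoodBelowP dR n a b f ℓg m (glue hwin (rest, w)) ↔ NoGoodBelowP dR n a b f ℓg m (glue hwin (rest, w')) := by
      intro rest w w'
      have key : ∀ ρ < m, (GoodRunP dR n a b f ℓg ℓg ρ (glue hwin (rest, w)) ↔ GoodRunP dR n a b f ℓg ℓg ρ (glue hwin (rest, w'))) := by
        intro ρ hρm
        have hρ' : ρ < RepsP n a b ℓg := by omega
        have hdis : lvlCoffP n a b ℓg + ρ * lvlSlotP n a b ℓg + lvlRunLenP n a b ℓg ≤ lvlCoffP n a b ℓg + m * lvlSlotP n a b ℓg := by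
          have : (ρ + 1) * lvlSlotP n a b ℓg ≤ m * lvlSlotP n a b ℓg := Nat.mul_le_mul_right _ hρm
          rw [Nat.succ_mul] at this; unfold lvlSlotP at this ⊢; omega
        rw [goodRunP_iff hρ', goodRunP_iff hρ', windowRead_glue_of_disjoint hwin (segWindowP_le le_rfl hρ') (Or.inl hdis)]
      simp only [NoGoodBelowP]
      exact forall₂_congr fun ρ hρm => by rw [key ρ hρm]
    have hstep := card_filter_and_window hwin (NoGoodBelowP dR n a b f ℓg m) (fun w => ¬ GoodWP dR n a b f ℓg w) hind
    have ih := card_noGoodBelowP_mul m (by omega)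
    rw [hsplit, pow_succ, ← mul_assoc, mul_comm ((univ.filter fun rv => NoGoodBelowP dR n a b f ℓg m rv ∧ _).card),
      show (2 ^ lvlRunLenP n a b ℓg) ^ m * (univ.filter fun rv => NoGoodBelowP dR n a b f ℓg m rv ∧
          ¬GoodWP dR n a b f ℓg (windowRead hwin rv)).card * 2 ^ lvlRunLenP n a b ℓg =
        (2 ^ lvlRunLenP n a b ℓg) ^ m * ((univ.filter (NoGoodBelowP dR n a b f ℓg m)).card *
          (univ.filter fun w => ¬ GoodWP dR n a b f ℓg w).card) by rw [mul_assoc, hstep],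
      ← mul_assoc, mul_comm ((2 ^ lvlRunLenP n a b ℓg) ^ m), ih, pow_succ, mul_assoc]

/-- `¬GoodW` has at most `(1-p₀)·2^{RL}` elements if `GoodW` has at least `p₀·2^{RL}`. [folklore] -/
theorem card_not_goodWP_le {p₀ : ℝ} (hp : p₀ * 2 ^ lvlRunLenP n a b ℓg ≤ ((univ.filter (GoodWP dR n a b f ℓg)).card : ℝ)) :
    ((univ.filter fun w => ¬ GoodWP dR n a b f ℓg w).card : ℝ) ≤ (1 - p₀) * 2 ^ lvlRunLenP n a b ℓg := by
  have hsum := Finset.card_filter_add_card_filter_not (s := (univ : Finset (Fin (lvlRunLenP n a b ℓg) → Bool))) (GoodWP dR n a b f ℓg)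
  rw [Finset.card_univ, Fintype.card_fun, Fintype.card_fin, Fintype.card_bool] at hsum
  have hcast : ((univ.filter (GoodWP dR n a b f ℓg)).card : ℝ) + ((univ.filter fun w => ¬ GoodWP dR n a b f ℓg w).card : ℝ) =
      2 ^ lvlRunLenP n a b ℓg := by exact_mod_cast hsum
  linarith

/-- **No good run among the `Reps` runs of level `ℓg` is rare**: `≤ (1 - p₀)^{Reps} · 2^{coinLen}`.
[cite: CarmosinoImpagliazzoKabanetsKolokolova2016, Thm. 5.1 (proof)] -/
theorem card_noGoodP_le {p₀ : ℝ} (hp : p₀ * 2 ^ lvlRunLenP n a b ℓg ≤ ((univ.filter (GoodWP dR n a b f ℓg)).card : ℝ)) :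
    ((univ.filter (NoGoodBelowP dR n a b f ℓg (RepsP n a b ℓg))).card : ℝ) ≤ (1 - p₀) ^ RepsP n a b ℓg * 2 ^ coinLenP n a b ℓg := by
  have hid := card_noGoodBelowP_mul (dR := dR) (f := f) (RepsP n a b ℓg) le_rfl
  have hidR : ((univ.filter (NoGoodBelowP dR n a b f ℓg (RepsP n a b ℓg))).card : ℝ) * ((2 : ℝ) ^ lvlRunLenP n a b ℓg) ^ RepsP n a b ℓg =
      2 ^ coinLenP n a b ℓg * ((univ.filter fun w => ¬ GoodWP dR n a b f ℓg w).card : ℝ) ^ RepsP n a b ℓg := by exact_mod_cast hid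
  have hbad := card_not_goodWP_le hp
  have hpos : (0 : ℝ) < ((2 : ℝ) ^ lvlRunLenP n a b ℓg) ^ RepsP n a b ℓg := pow_pos (pow_pos two_pos _) _
  have hG0 : (0 : ℝ) ≤ ((univ.filter fun w => ¬ GoodWP dR n a b f ℓg w).card : ℝ) := Nat.cast_nonneg _
  have hpow := pow_le_pow_left₀ hG0 hbad (RepsP n a b ℓg)
  refine le_of_mul_le_mul_right ?_ hpos
  calc ((univ.filter (NoGoodBelowP dR n a b f ℓg (RepsP n a b ℓg))).card : ℝ) * ((2 : ℝ) ^ lvlRunLenP n a b ℓg) ^ RepsP n a b ℓg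
      = 2 ^ coinLenP n a b ℓg * ((univ.filter fun w => ¬ GoodWP dR n a b f ℓg w).card : ℝ) ^ RepsP n a b ℓg := hidR
    _ ≤ 2 ^ coinLenP n a b ℓg * (((1 - p₀) * 2 ^ lvlRunLenP n a b ℓg) ^ RepsP n a b ℓg) := mul_le_mul_of_nonneg_left hpow (pow_nonneg two_pos.le _)
    _ = (1 - p₀) ^ RepsP n a b ℓg * 2 ^ coinLenP n a b ℓg * ((2 : ℝ) ^ lvlRunLenP n a b ℓg) ^ RepsP n a b ℓg := by rw [mul_pow]; ring

end NoGood

/-! ### Good windows from good typed coins -/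

section GoodW

variable {n a b : ℕ} (R : CombinatorialProperty) {dR : List Bool → List Bool} (hdRFP : dR ∈ FP)
  (hdR : ∀ y, dR y = encodeBool ((truthTableLanguage R).boolIndicator y)) (f : (Fin n → Bool) → Bool) (ℓg : ℕ)

/-- The typed run coins of level `ℓ`. [folklore] -/
abbrev RunLvl (n a b ℓ : ℕ) : Type :=
  RunCoinsP n 𝔭 (βP n a b ℓ) (2 ^ κP n a b ℓ) (2 ^ τP ℓ) (2 ^ ℓ) (𝔭 ^ teP n a b ℓ * 𝔭 ^ teP n a b ℓ) (kkP n a b ℓ) (tP n a b ℓ)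

/-- The window assignment of an extended coin tuple: the bits of its written segment. [folklore] -/
noncomputable def wOf (e : ExtLvl n a b ℓg) : Fin (lvlRunLenP n a b ℓg) → Bool := fun i => (extList e).getD i false

/-- The window assignment lists the written segment. [folklore] -/
theorem ofFn_wOf (e : ExtLvl n a b ℓg) : List.ofFn (wOf ℓg e) = extList e := by
  have hlen : (extList e).length = lvlRunLenP n a b ℓg := length_extList e
  apply List.ext_getElem
  · rw [List.length_ofFn, hlen]
  · intro i h1 h2
    rw [List.getElem_ofFn, wOf, List.getD_eq_getElem _ _ h2]

/-- `wOf` is injective. [folklore] -/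
theorem wOf_injective : Function.Injective (wOf (n := n) (a := a) (b := b) ℓg) := fun e e' h =>
  extList_injective (jB_pos_lvl n a b ℓg) (by rw [← ofFn_wOf ℓg e, ← ofFn_wOf ℓg e', h])

include hdRFP hdR in
/-- **The hypothesis of the window of typed coins is the typed hypothesis.** [folklore] -/
theorem hypW_wOf (e : ExtLvl n a b ℓg) : hypW dR n a b f ℓg (wOf ℓg e) = typedHyp R n a b ℓg f e.1 := by
  funext x
  rw [hypW, ofFn_wOf, predN_extList R hdRFP hdR f e x]

include hdRFP hdR in
/-- **Good typed coins give good windows**: if `p₁ · #RunCoins ≤ #{ω | 2a · err(typedHyp ω) ≤ 2ⁿ}` then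
`p₁ (1 - p N_b/2^β) 2^{runLen} ≤ #{GoodW}`. [cite: CarmosinoImpagliazzoKabanetsKolokolova2016, Thm. 5.1 (proof)] -/
theorem card_goodWP_ge {p₁ : ℝ} (hp₁ : 0 ≤ p₁)
    (hGT : p₁ * Fintype.card (RunLvl n a b ℓg) ≤ ((univ.filter fun ω : RunLvl n a b ℓg => 2 * a * errCount n f (typedHyp R n a b ℓg f ω) ≤ 2 ^ n).card : ℝ)) :
    p₁ * (1 - (𝔭 : ℝ) * nBlocks (κP n a b ℓg) (τP ℓg) (kkP n a b ℓg) (tP n a b ℓg) / (2 : ℝ) ^ βP n a b ℓg) * 2 ^ lvlRunLenP n a b ℓg ≤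
      ((univ.filter (GoodWP dR n a b f ℓg)).card : ℝ) := by
  classical
  -- the good extended tuples inject into the good windows
  set GE := (univ.filter fun e : ExtLvl n a b ℓg => 2 * a * errCount n f (typedHyp R n a b ℓg f e.1) ≤ 2 ^ n) with hGE
  have himg : (GE.image (wOf ℓg)).card = GE.card := Finset.card_image_of_injective _ (wOf_injective ℓg)
  have hsub : GE.image (wOf ℓg) ⊆ univ.filter (GoodWP dR n a b f ℓg) := by
    intro w hw
    obtain ⟨e, he, rfl⟩ := Finset.mem_image.1 hw
    rw [hGE, Finset.mem_filter] at he
    rw [Finset.mem_filter, GoodWP, hypW_wOf R hdRFP hdR f ℓg e]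
    exact ⟨Finset.mem_univ _, he.2⟩
  -- `#GE = #GT · #Extra`
  have hGEeq : GE = (univ.filter fun ω : RunLvl n a b ℓg => 2 * a * errCount n f (typedHyp R n a b ℓg f ω) ≤ 2 ^ n) ×ˢ
      (univ : Finset (ExtraP (κP n a b ℓg) (βP n a b ℓg) (τP ℓg) (kkP n a b ℓg) (tP n a b ℓg))) := by
    rw [hGE, ← Finset.univ_product_univ, Finset.filter_product_left (fun ω : RunLvl n a b ℓg => 2 * a * errCount n f (typedHyp R n a b ℓg f ω) ≤ 2 ^ n)]
  have hGEcard : (GE.card : ℝ) = ((univ.filter fun ω : RunLvl n a b ℓg => 2 * a * errCount n f (typedHyp R n a b ℓg f ω) ≤ 2 ^ n).card : ℝ) *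
      Fintype.card (ExtraP (κP n a b ℓg) (βP n a b ℓg) (τP ℓg) (kkP n a b ℓg) (tP n a b ℓg)) := by
    rw [hGEeq, Finset.card_product, Finset.card_univ]; push_cast; ring
  have hExt : (Fintype.card (ExtLvl n a b ℓg) : ℝ) = Fintype.card (RunLvl n a b ℓg) *
      Fintype.card (ExtraP (κP n a b ℓg) (βP n a b ℓg) (τP ℓg) (kkP n a b ℓg) (tP n a b ℓg)) := by
    rw [show (Fintype.card (ExtLvl n a b ℓg) : ℝ) = ((Fintype.card (RunLvl n a b ℓg ×
      ExtraP (κP n a b ℓg) (βP n a b ℓg) (τP ℓg) (kkP n a b ℓg) (tP n a b ℓg)) : ℕ) : ℝ) from rfl, Fintype.card_prod]; push_cast; ring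
  have hcardExt := card_ExtCoinsP_ge (teP n a b ℓg) ℓg n (κP n a b ℓg) (βP n a b ℓg) (τP ℓg) (kkP n a b ℓg) (tP n a b ℓg) (p_le_two_pow_βP n a b ℓg)
  have hX0 : (0 : ℝ) ≤ Fintype.card (ExtraP (κP n a b ℓg) (βP n a b ℓg) (τP ℓg) (kkP n a b ℓg) (tP n a b ℓg)) := Nat.cast_nonneg _
  calc p₁ * (1 - (𝔭 : ℝ) * nBlocks (κP n a b ℓg) (τP ℓg) (kkP n a b ℓg) (tP n a b ℓg) / (2 : ℝ) ^ βP n a b ℓg) * 2 ^ lvlRunLenP n a b ℓg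
      = p₁ * ((1 - (𝔭 : ℝ) * nBlocks (κP n a b ℓg) (τP ℓg) (kkP n a b ℓg) (tP n a b ℓg) / (2 : ℝ) ^ βP n a b ℓg) *
          2 ^ runLenP n (2 ^ κP n a b ℓg) (βP n a b ℓg) (2 ^ τP ℓg) ℓg (𝔭 ^ teP n a b ℓg) (2 ^ ℓg) (kkP n a b ℓg) (tP n a b ℓg) (κP n a b ℓg) (τP ℓg)) := by
        rw [mul_assoc]; rfl
    _ ≤ p₁ * Fintype.card (ExtLvl n a b ℓg) := mul_le_mul_of_nonneg_left hcardExt hp₁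
    _ = p₁ * Fintype.card (RunLvl n a b ℓg) * Fintype.card (ExtraP (κP n a b ℓg) (βP n a b ℓg) (τP ℓg) (kkP n a b ℓg) (tP n a b ℓg)) := by
        rw [hExt]; ring
    _ ≤ ((univ.filter fun ω : RunLvl n a b ℓg => 2 * a * errCount n f (typedHyp R n a b ℓg f ω) ≤ 2 ^ n).card : ℝ) *
          Fintype.card (ExtraP (κP n a b ℓg) (βP n a b ℓg) (τP ℓg) (kkP n a b ℓg) (tP n a b ℓg)) := mul_le_mul_of_nonneg_right hGT hX0
    _ = GE.card := hGEcard.symm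
    _ = (GE.image (wOf ℓg)).card := by rw [himg]
    _ ≤ ((univ.filter (GoodWP dR n a b f ℓg)).card : ℝ) := by exact_mod_cast Finset.card_le_card hsub

end GoodW

/-! ### Validation: misleading tests are rare -/

section Validation

variable {n a b : ℕ} {dR : List Bool → List Bool} {f : (Fin n → Bool) → Bool} {ℓg : ℕ}

/-- The validation window of level `ℓ ≤ ℓg` fits into the coins. [folklore] -/
theorem valWindowP_le {ℓ : ℕ} (hℓ : ℓ ≤ ℓg) : lvlCoffP n a b ℓ + RepsP n a b ℓ * lvlSlotP n a b ℓ + MP n a b ℓ * n ≤ coinLenP n a b ℓg := by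
  have h := (processedP_iff (n := n) (a := a) (b := b) ℓg ℓ).2 hℓ
  rw [LvlProcessedP, lvlCoffP, Finset.sum_range_succ, ← lvlCoffP, lvlBlockLenP, ← Nat.add_assoc] at h
  exact h

/-- **The validation points are read off the validation window.** [folklore] -/
theorem rdBits_lvlValPtP {ℓ : ℕ} (hℓ : ℓ ≤ ℓg) (rv : Fin (coinLenP n a b ℓg) → Bool) {wv : ℕ} (hwv : wv < MP n a b ℓ) :
    rdBits (lvlValPtP n a b (coinsListP n a b ℓg rv) ℓ wv) 0 n = fun d : Fin n =>
      windowRead (valWindowP_le hℓ) rv ⟨wv * n + d, by have := item_fits (c := n) hwv; omega⟩ := by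
  funext d
  have hfit := item_fits (c := n) hwv
  have hC := valWindowP_le (n := n) (a := a) (b := b) hℓ
  have hd := d.isLt
  have e1 : rdBits (lvlValPtP n a b (coinsListP n a b ℓg rv) ℓ wv) 0 n d =
      (List.ofFn rv).getD (lvlCoffP n a b ℓ + RepsP n a b ℓ * lvlSlotP n a b ℓ + wv * n + (d : ℕ)) false := by
    rw [lvlValPtP, rdBits_sl, rdBits]
  have e2 : (List.ofFn rv).getD (lvlCoffP n a b ℓ + RepsP n a b ℓ * lvlSlotP n a b ℓ + wv * n + (d : ℕ)) false =
      rv ⟨lvlCoffP n a b ℓ + RepsP n a b ℓ * lvlSlotP n a b ℓ + wv * n + (d : ℕ), by omega⟩ := by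
    rw [List.getD_eq_getElem _ _ (by rw [List.length_ofFn]; omega), List.getElem_ofFn]
  rw [e1, e2]
  simp only [windowRead]
  exact congrArg rv (Fin.ext (by simp only; omega))

/-- The test is `4a · errs ≤ 3M`. [folklore] -/
theorem passesP_iff {ℓ ρ : ℕ} (rv : Fin (coinLenP n a b ℓg) → Bool) :
    PassesP dR n a b f ℓg ℓ ρ rv ↔ 4 * a * errsN dR n a b (coinsListP n a b ℓg rv) (ansOfP n a b f ℓg rv) ℓ ρ ≤ 3 * MP n a b ℓ := by
  rw [PassesP, passesN, decide_eq_true_eq]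

/-- **The error count of a candidate on the validation sample** as a count over the window. [folklore] -/
theorem errsN_eq_window {ℓ : ℕ} (hℓ : ℓ ≤ ℓg) (ρ : ℕ) (rv : Fin (coinLenP n a b ℓg) → Bool) :
    errsN dR n a b (coinsListP n a b ℓg rv) (ansOfP n a b f ℓg rv) ℓ ρ =
      ((Finset.range (MP n a b ℓ)).filter fun wv =>
        if hwv : wv < MP n a b ℓ then
          hypRv dR n a b f ℓg ℓ ρ rv (fun d => windowRead (valWindowP_le hℓ) rv ⟨wv * n + d, by have := item_fits (c := n) hwv; omega⟩) ≠
            f (fun d => windowRead (valWindowP_le hℓ) rv ⟨wv * n + d, by have := item_fits (c := n) hwv; omega⟩)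
        else False).card := by
  have hproc : LvlProcessedP n a b (coinsListP n a b ℓg rv).length ℓ := by rw [List.length_ofFn]; exact (processedP_iff ℓg ℓ).2 hℓ
  rw [errsN_eq hproc ρ (queries_suffice hℓ rv)]
  refine congrArg Finset.card (Finset.filter_congr fun wv hwv => ?_)
  rw [Finset.mem_range] at hwv
  rw [dif_pos hwv, rdBits_lvlValPtP hℓ rv hwv]

/-- `M > 0`. [folklore] -/
theorem MP_pos (n a b ℓ : ℕ) : 0 < MP n a b ℓ := by unfold MP; positivity

/-- **A misleading validation is rare**: `#{rv | BadV ℓ ρ rv} ≤ 2 e^{-2M(1/4a)²} · 2^{coinLen}`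
(`ℓ ≤ ℓg`, `ρ < Reps ℓ`, `a ≥ 1`). [cite: CarmosinoImpagliazzoKabanetsKolokolova2016, Thm. 5.1 (proof: validation by Chernoff–Hoeffding)] -/
theorem card_badVP_le (ha : 1 ≤ a) {ℓ : ℕ} (hℓ : ℓ ≤ ℓg) {ρ : ℕ} (hρ : ρ < RepsP n a b ℓ) :
    ((univ.filter (BadVP dR n a b f ℓg ℓ ρ)).card : ℝ) ≤ 2 * Real.exp (-2 * MP n a b ℓ * (1 / (4 * a)) ^ 2) * 2 ^ coinLenP n a b ℓg := by
  have hM := MP_pos n a b ℓ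
  have hV := valWindowP_le (n := n) (a := a) (b := b) hℓ
  have hsegW := segWindowP_le (n := n) (a := a) (b := b) hℓ hρ
  -- the run window lies before the validation window
  have hdis : lvlCoffP n a b ℓ + ρ * lvlSlotP n a b ℓ + lvlRunLenP n a b ℓ ≤ lvlCoffP n a b ℓ + RepsP n a b ℓ * lvlSlotP n a b ℓ := by
    have : (ρ + 1) * lvlSlotP n a b ℓ ≤ RepsP n a b ℓ * lvlSlotP n a b ℓ := Nat.mul_le_mul_right _ hρ
    rw [Nat.succ_mul] at this; unfold lvlSlotP at this ⊢; omega
  -- fibre bound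
  have hfib : ∀ rest : Fin (coinLenP n a b ℓg - (MP n a b ℓ) * n) → Bool,
      ((univ.filter fun w : Fin ((MP n a b ℓ) * n) → Bool => BadVP dR n a b f ℓg ℓ ρ (glue hV (rest, w))).card : ℝ) ≤
        2 * Real.exp (-2 * (MP n a b ℓ) * (1 / (4 * a)) ^ 2) * 2 ^ (n * (MP n a b ℓ)) := by
    intro rest
    set h₀ := hypRv dR n a b f ℓg ℓ ρ (glue hV (rest, fun _ => false)) with hh₀
    have hind : ∀ w, hypRv dR n a b f ℓg ℓ ρ (glue hV (rest, w)) = h₀ := by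
      intro w
      rw [hh₀, hypRv_eq_hypW hℓ hρ, hypRv_eq_hypW hℓ hρ, windowRead_glue_of_disjoint hV hsegW (Or.inl hdis)]
    have herrs : ∀ w, errsN dR n a b (coinsListP n a b ℓg (glue hV (rest, w))) (ansOfP n a b f ℓg (glue hV (rest, w))) ℓ ρ =
        sampleErrs f h₀ (sampleOf w) := by
      intro w
      rw [errsN_eq_window hℓ ρ, sampleErrs, ← card_filter_range_dite]
      refine congrArg Finset.card (Finset.filter_congr fun wv hwv => ?_)
      rw [Finset.mem_range] at hwv
      rw [dif_pos hwv, dif_pos hwv]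
      have hpt : (fun d : Fin n => windowRead hV (glue hV (rest, w)) ⟨wv * n + d, by have := item_fits (c := n) hwv; omega⟩) = sampleOf w ⟨wv, hwv⟩ := by
        funext d
        rw [windowRead_glue, sampleOf, finProdFinEquiv_eq_mk]
      rw [show hypRv dR n a b f ℓg ℓ ρ (glue hV (rest, w)) = h₀ from hind w, hpt]
    have hsub : (univ.filter fun w : Fin ((MP n a b ℓ) * n) → Bool => BadVP dR n a b f ℓg ℓ ρ (glue hV (rest, w))) ⊆
        (univ.filter fun w => 2 ^ n < a * errCount n f h₀ ∧ 4 * a * sampleErrs f h₀ (sampleOf w) ≤ 3 * (MP n a b ℓ)) ∪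
        (univ.filter fun w => 2 * a * errCount n f h₀ ≤ 2 ^ n ∧ 3 * (MP n a b ℓ) < 4 * a * sampleErrs f h₀ (sampleOf w)) := by
      intro w hw
      simp only [Finset.mem_filter, Finset.mem_univ, true_and, Finset.mem_union] at hw ⊢
      simp only [BadVP, GoodRunP, hind w, passesP_iff, herrs w] at hw
      rcases hw with ⟨h1, h2⟩ | ⟨h1, h2⟩
      · exact Or.inl ⟨h1, h2⟩
      · exact Or.inr ⟨h1, not_le.1 h2⟩
    have htail : ∀ (Q : (Fin (MP n a b ℓ) → (Fin n → Bool)) → Prop) [DecidablePred Q],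
        (univ.filter fun w : Fin ((MP n a b ℓ) * n) → Bool => Q (sampleOf w)).card = (univ.filter Q).card := by
      intro Q _
      rw [← card_filter_univ_equiv (sampleEquiv (MP n a b ℓ) n) Q]
      refine congrArg Finset.card (Finset.filter_congr fun w _ => by rw [sampleEquiv_apply])
    refine le_trans (Nat.cast_le.2 ((Finset.card_le_card hsub).trans (Finset.card_union_le _ _))) ?_
    push_cast
    have hexp : 0 ≤ Real.exp (-2 * (MP n a b ℓ) * (1 / (4 * a)) ^ 2) * 2 ^ (n * (MP n a b ℓ)) := by positivity
    have t1 : ((univ.filter fun w : Fin ((MP n a b ℓ) * n) → Bool => 2 ^ n < a * errCount n f h₀ ∧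
        4 * a * sampleErrs f h₀ (sampleOf w) ≤ 3 * (MP n a b ℓ)).card : ℝ) ≤ Real.exp (-2 * (MP n a b ℓ) * (1 / (4 * a)) ^ 2) * 2 ^ (n * (MP n a b ℓ)) := by
      by_cases hc : 2 ^ n < a * errCount n f h₀
      · rw [Finset.filter_congr (q := fun w => 4 * a * sampleErrs f h₀ (sampleOf w) ≤ 3 * (MP n a b ℓ)) (fun w _ => by simp [hc]),
          htail (fun ω => 4 * a * sampleErrs f h₀ ω ≤ 3 * (MP n a b ℓ))]
        exact card_sample_passes_le ha hM h₀ hc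
      · rw [Finset.filter_false_of_mem (fun w _ => by simp [hc]), Finset.card_empty, Nat.cast_zero]; exact hexp
    have t2 : ((univ.filter fun w : Fin ((MP n a b ℓ) * n) → Bool => 2 * a * errCount n f h₀ ≤ 2 ^ n ∧
        3 * (MP n a b ℓ) < 4 * a * sampleErrs f h₀ (sampleOf w)).card : ℝ) ≤ Real.exp (-2 * (MP n a b ℓ) * (1 / (4 * a)) ^ 2) * 2 ^ (n * (MP n a b ℓ)) := by
      by_cases hc : 2 * a * errCount n f h₀ ≤ 2 ^ n
      · rw [Finset.filter_congr (q := fun w => 3 * (MP n a b ℓ) < 4 * a * sampleErrs f h₀ (sampleOf w)) (fun w _ => by simp [hc]),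
          htail (fun ω => 3 * (MP n a b ℓ) < 4 * a * sampleErrs f h₀ ω)]
        exact card_sample_fails_le ha hM h₀ hc
      · rw [Finset.filter_false_of_mem (fun w _ => by simp [hc]), Finset.card_empty, Nat.cast_zero]; exact hexp
    linarith
  have := card_filter_window_le hV (BadVP dR n a b f ℓg ℓ ρ) hfib
  refine this.trans (le_of_eq ?_)
  have hC : n * (MP n a b ℓ) + (coinLenP n a b ℓg - (MP n a b ℓ) * n) = coinLenP n a b ℓg := by
    rw [mul_comm]; exact Nat.add_sub_cancel' (le_trans (Nat.le_add_left _ _) hV)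
  rw [mul_assoc (2 * Real.exp _), ← pow_add, hC]

end Validation

/-! ### The union bound -/

section Union

variable {n a b : ℕ} {dR : List Bool → List Bool} {f : (Fin n → Bool) → Bool} {ℓg : ℕ}

/-- **Failure is covered by "no good run" and the misleading validations.** [folklore] -/
theorem not_successP_subset :
    (univ.filter fun rv => ¬ SuccessP dR n a b f ℓg rv) ⊆
      (univ.filter (NoGoodBelowP dR n a b f ℓg (RepsP n a b ℓg))) ∪
        (Finset.range (ℓg + 1)).biUnion fun ℓ => (Finset.range (RepsP n a b ℓ)).biUnion fun ρ => univ.filter (BadVP dR n a b f ℓg ℓ ρ) := by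
  intro rv hrv
  simp only [Finset.mem_filter, Finset.mem_univ, true_and] at hrv
  simp only [Finset.mem_union, Finset.mem_filter, Finset.mem_univ, true_and, Finset.mem_biUnion, Finset.mem_range]
  by_contra hc
  rw [not_or, not_exists] at hc
  obtain ⟨h1, h2⟩ := hc
  apply hrv
  refine successP_of rv ?_ fun ℓ hℓ ρ hρ hbad => h2 ℓ ⟨Nat.lt_succ_of_le hℓ, ρ, hρ, hbad⟩
  rw [NoGoodBelowP] at h1
  simp only [not_forall, not_not, exists_prop] at h1
  exact h1

/-- **The failure count of the learner** (over uniform coins of length `coinLen ℓg`):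
`#{¬Success} ≤ ((1-p₀)^{Reps(ℓg)} + Σ_{ℓ ≤ ℓg} Reps(ℓ)·2e^{-2M(ℓ)/(16a²)})·2^{coinLen}`.
[cite: CarmosinoImpagliazzoKabanetsKolokolova2016, Thm. 5.1 (proof)] -/
theorem card_not_successP_le (ha : 1 ≤ a) {p₀ : ℝ} (hp : p₀ * 2 ^ lvlRunLenP n a b ℓg ≤ ((univ.filter (GoodWP dR n a b f ℓg)).card : ℝ)) :
    ((univ.filter fun rv => ¬ SuccessP dR n a b f ℓg rv).card : ℝ) ≤
      ((1 - p₀) ^ RepsP n a b ℓg + ∑ ℓ ∈ Finset.range (ℓg + 1), RepsP n a b ℓ * (2 * Real.exp (-2 * MP n a b ℓ * (1 / (4 * a)) ^ 2))) *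
        2 ^ coinLenP n a b ℓg := by
  have h1 := card_noGoodP_le (dR := dR) (f := f) hp
  have hsub := not_successP_subset (n := n) (a := a) (b := b) (dR := dR) (f := f) (ℓg := ℓg)
  have hcard := (Finset.card_le_card hsub).trans (Finset.card_union_le _ _)
  have hbi : ((Finset.range (ℓg + 1)).biUnion fun ℓ => (Finset.range (RepsP n a b ℓ)).biUnion fun ρ => univ.filter (BadVP dR n a b f ℓg ℓ ρ)).card ≤
      ∑ ℓ ∈ Finset.range (ℓg + 1), ∑ ρ ∈ Finset.range (RepsP n a b ℓ), (univ.filter (BadVP dR n a b f ℓg ℓ ρ)).card :=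
    Finset.card_biUnion_le.trans (Finset.sum_le_sum fun ℓ _ => Finset.card_biUnion_le)
  have hsum : (∑ ℓ ∈ Finset.range (ℓg + 1), ∑ ρ ∈ Finset.range (RepsP n a b ℓ), ((univ.filter (BadVP dR n a b f ℓg ℓ ρ)).card : ℝ)) ≤
      ∑ ℓ ∈ Finset.range (ℓg + 1), RepsP n a b ℓ * (2 * Real.exp (-2 * MP n a b ℓ * (1 / (4 * a)) ^ 2)) * 2 ^ coinLenP n a b ℓg := by
    refine Finset.sum_le_sum fun ℓ hℓ => ?_
    rw [Finset.mem_range] at hℓ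
    calc ∑ ρ ∈ Finset.range (RepsP n a b ℓ), ((univ.filter (BadVP dR n a b f ℓg ℓ ρ)).card : ℝ)
        ≤ ∑ _ρ ∈ Finset.range (RepsP n a b ℓ), 2 * Real.exp (-2 * MP n a b ℓ * (1 / (4 * a)) ^ 2) * 2 ^ coinLenP n a b ℓg :=
          Finset.sum_le_sum fun ρ hρ => card_badVP_le ha (Nat.le_of_lt_succ hℓ) (Finset.mem_range.1 hρ)
      _ = RepsP n a b ℓ * (2 * Real.exp (-2 * MP n a b ℓ * (1 / (4 * a)) ^ 2)) * 2 ^ coinLenP n a b ℓg := by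
          rw [Finset.sum_const, Finset.card_range, nsmul_eq_mul]; ring
  have hcardR : ((univ.filter fun rv => ¬ SuccessP dR n a b f ℓg rv).card : ℝ) ≤
      ((univ.filter (NoGoodBelowP dR n a b f ℓg (RepsP n a b ℓg))).card : ℝ) +
      ∑ ℓ ∈ Finset.range (ℓg + 1), ∑ ρ ∈ Finset.range (RepsP n a b ℓ), ((univ.filter (BadVP dR n a b f ℓg ℓ ρ)).card : ℝ) := by
    have := hcard.trans (Nat.add_le_add_left hbi _)
    exact_mod_cast this
  rw [add_mul, Finset.sum_mul]
  linarith

end Union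

end Modp

end Literature.Computability.Learning


/-!
## Part — The `AC⁰[p]` learner: good levels and the count of good typed coins

Analysis for the named fact `Literature.Computability.Learning.cikk_learn_AC0Mod` (CIKK 2016,
Cor. 5.4): the usefulness of Smolensky's natural property `rsProperty p` against the NW outputs of
`AMP_p(f)` for `f ∈ AC⁰[p]` of depth `d` and size `n^{k₀} + k₀` (`AmpPCircuit.ampPNW_not_mem_rsProperty`)
at a **good level** `ℓ` (`GoodLevelP`), giving the predictor advantage `≥ 1/5`
(`hadv_of_goodLevelP`, largeness `≥ 1/2 ≥ 1/5` of `rsProperty`); and the count of good typed run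
coins at such a level (`card_typedGood_ge`: `AmpPRun.card_goodRunP_ge` under the level's analytic
hypotheses `LvlHyps`, discharged in `ParamsIneqP`).

## References

* M. Carmosino, R. Impagliazzo, V. Kabanets, A. Kolokolova, *Learning algorithms from natural
  proofs*, CCC 2016, Lem. 3.4, Thm. 5.1, Cor. 5.4 [CarmosinoImpagliazzoKabanetsKolokolova2016].
* R. Smolensky, *Algebraic methods in the theory of lower bounds for Boolean circuit complexity*, STOC 1987 [Smolensky1987].
-/

namespace Literature.Computability.Learning

namespace Modp

open Literature.Computability.Complexity Literature.Computability.Complexity.DirectProduct Literature.Computability.Complexity.GaussRank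
  Literature.Computability.MetaComplexity Literature.Computability.MetaComplexity.Smolensky Literature.Computability.Cryptography
  _root_.Computability Finset Circuit

variable [P : PrimeP]

-- the nested coin products exceed the default instance size bound
set_option synthInstance.maxSize 2048
set_option synthInstance.maxHeartbeats 400000

/-! ### Good levels -/

section Good

/-- **A good level** for depth `d` and size exponent `k₀`: some degree scale `ℓ'` satisfies the
degree and size hypotheses of `ampPNW_not_mem_rsProperty` at the level's parameters.
[cite: CarmosinoImpagliazzoKabanetsKolokolova2016, Thm. 5.1 (proof: choice of `ℓ`)] -/
def GoodLevelP (d k₀ n a b ℓ : ℕ) : Prop :=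
  1 ≤ ℓ ∧ ∃ ℓ', 1 ≤ ℓ' ∧ 64 * ((𝔭 - 1) * ℓ') ^ (2 * (d + 11)) ≤ oddFloor ℓ ∧
    16 * ampPSize n (kP n a b ℓ) (βP n a b ℓ) (TP ℓ) ℓ (teP n a b ℓ) 𝔭 (n ^ k₀ + k₀) < 𝔭 ^ ℓ'

/-- `rsProperty p` has density `≥ 1/5` at every length. [folklore] -/
theorem rsProperty_dense (ℓ : ℕ) : 2 ^ (2 ^ ℓ) ≤ 5 * Nat.card (rsProperty 𝔭 ℓ) :=
  (two_pow_le_two_mul_card_rsProperty 𝔭 ℓ).trans (Nat.mul_le_mul_right _ (by norm_num))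

/-- **At a good level the property distinguishes the generator**, for every target in `AC⁰[p]` of
depth `d` and size `n^{k₀} + k₀`. [cite: CarmosinoImpagliazzoKabanetsKolokolova2016, Lem. 3.4, Thm. 5.1] -/
theorem hadv_of_goodLevelP {d k₀ n a b ℓ : ℕ} (hgood : GoodLevelP d k₀ n a b ℓ) {f : (Fin n → Bool) → Bool} (hf : f ∈ ac0ModClass 𝔭 d k₀ n) :
    (1 / 5 : ℝ) ≤ advantage (natTest (rsProperty 𝔭) ℓ)
      (nwGenerator (designP (teP_ne_zero n a b ℓ) _ ℓ (lvl_hn n a b ℓ)) (ampPFin 𝔭 f (kP n a b ℓ) (βP n a b ℓ) (TP ℓ))) := by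
  obtain ⟨hℓ, ℓ', hℓ', hdeg, hsize⟩ := hgood
  obtain ⟨C, hCo, hCd, hCs, hCf⟩ := hf
  refine natTest_advantage_ge (rsProperty 𝔭) ℓ (rsProperty_dense ℓ) _ fun z => ?_
  rw [nwGenerator_designP_comp]
  have hfC : f = fun x => C.eval x := funext fun x => (hCf x).symm
  rw [hfC]
  exact ampPNW_not_mem_rsProperty (teP_ne_zero n a b ℓ) (lvl_hn n a b ℓ) C hCo z hCd hCs hℓ hℓ' hdeg hsize

end Good

/-! ### The count of good typed coins -/

section Typed

variable (n a b ℓ : ℕ)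

/-- The quantities of `card_goodRunP_ge` at level `ℓ`: `ν`, `μ`, `ρ`, `p₀`. [folklore] -/
noncomputable def nuP : ℝ := (TP ℓ * 2 : ℕ) * kP n a b ℓ * 𝔭 / (2 : ℝ) ^ βP n a b ℓ

/-- `μ = (1/(10L) - 2ν - 1/(2p^T))/(p·2T)`. [folklore] -/
noncomputable def muP : ℝ := (1 / (10 * (2 ^ ℓ : ℕ)) - 2 * nuP n a b ℓ - 1 / (2 * (𝔭 : ℝ) ^ TP ℓ)) / (𝔭 * (TP ℓ * 2 : ℕ))

/-- `ρ = μ/2/(8 p^{kk})`. [folklore] -/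
noncomputable def rhoP : ℝ := muP n a b ℓ / 2 / (8 * (𝔭 : ℝ) ^ kkP n a b ℓ)

/-- **The one-run success probability** `p₀ = η₁ (μ/2) ρ (3ρ/16)(1 - 2e^{-k/8}) / 2`. [folklore] -/
noncomputable def pZeroP : ℝ :=
  1 / (10 * (2 ^ ℓ : ℕ)) * (muP n a b ℓ / 2) * rhoP n a b ℓ * (3 * rhoP n a b ℓ / 16 * (1 - 2 * Real.exp (-(kP n a b ℓ / 8 : ℝ)))) * (1 / 2)

/-- **The analytic hypotheses of level `ℓ`** (discharged in `ParamsIneqP` for `a ≥ 1`). [folklore] -/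
structure LvlHyps (n a b ℓ : ℕ) : Prop where
  hν : nuP n a b ℓ ≤ 1 / 2
  hμ : 0 ≤ muP n a b ℓ
  hm0 : 0 < (reps 𝔭 (kkP n a b ℓ)).card
  hGL : ((kP n a b ℓ + 1) * 𝔭 : ℝ) ≤ 2 * (muP n a b ℓ / 2 / 2 / (4 * 𝔭)) ^ 2 * (reps 𝔭 (kkP n a b ℓ)).card
  H1u : Real.exp (-(3 * (1 / (4 * (a : ℝ))) * kP n a b ℓ / 2048)) ≤ rhoP n a b ℓ ^ 2 * (1 / (4 * (a : ℝ))) / 4096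
  H2u : Real.exp (-(kP n a b ℓ * (1 / (4 * (a : ℝ))) ^ 2 / 2048)) ≤ rhoP n a b ℓ / 4
  H3u : Real.exp (-(tP n a b ℓ * rhoP n a b ℓ / 32)) ≤ 1 / (4 * (a : ℝ)) / 16
  hθ : (θNP n a b ℓ : ℝ) / θDP n a b ℓ = muP n a b ℓ / 2 / 2 / (4 * 𝔭)

variable {n a b ℓ}

/-- **The count of good typed coins at a good level** (advantage `≥ 1/5`, analytic hypotheses,
`a ≥ 1`): `p₀ · #RunCoins ≤ #{ω | 2a · err(typedHyp ω) ≤ 2ⁿ}`.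
[cite: CarmosinoImpagliazzoKabanetsKolokolova2016, Thm. 5.1 (proof) with Thm. 4.8] -/
theorem card_typedGood_ge (R : CombinatorialProperty) (f : (Fin n → Bool) → Bool) (ha : 1 ≤ a) (H : LvlHyps n a b ℓ)
    (hadv : (1 / 5 : ℝ) ≤ advantage (natTest R ℓ)
      (nwGenerator (designP (teP_ne_zero n a b ℓ) _ ℓ (lvl_hn n a b ℓ)) (ampPFin 𝔭 f (kP n a b ℓ) (βP n a b ℓ) (TP ℓ)))) :
    pZeroP n a b ℓ * Fintype.card (RunLvl n a b ℓ) ≤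
      ((univ.filter fun ω : RunLvl n a b ℓ => 2 * a * errCount n f (typedHyp R n a b ℓ f ω) ≤ 2 ^ n).card : ℝ) := by
  classical
  have haR : (0 : ℝ) < a := by exact_mod_cast ha
  have hδ₁ : (0 : ℝ) < 1 / (4 * a) := by positivity
  have h := card_goodRunP_ge (p := 𝔭) (n := n) (k := kP n a b ℓ) (β := βP n a b ℓ) (T := TP ℓ) (L := 2 ^ ℓ)
    (m := 𝔭 ^ teP n a b ℓ * 𝔭 ^ teP n a b ℓ) (kk := kkP n a b ℓ) (t := tP n a b ℓ)
    (designP (teP_ne_zero n a b ℓ) _ ℓ (lvl_hn n a b ℓ)) (natTest R ℓ) f (Nat.two_pow_pos ℓ) (kP_pos n a b ℓ) (TP_pos ℓ)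
    (p_le_two_pow_βP n a b ℓ) hadv H.hν H.hμ H.hm0 H.hGL hδ₁ H.H1u H.H2u H.H3u
  dsimp only at h
  have hcardEq : (Fintype.card (RunLvl n a b ℓ) : ℝ) =
      Fintype.card (RunCoinsP n 𝔭 (βP n a b ℓ) (kP n a b ℓ) (TP ℓ) (2 ^ ℓ) (𝔭 ^ teP n a b ℓ * 𝔭 ^ teP n a b ℓ) (kkP n a b ℓ) (tP n a b ℓ)) := rfl
  refine le_trans (le_of_eq ?_) (h.trans ?_)
  · rw [hcardEq]; simp only [pZeroP, rhoP, muP, nuP]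
  · refine Nat.cast_le.2 (Finset.card_le_card fun ω hω => Finset.mem_filter.2 ⟨Finset.mem_univ _, ?_⟩)
    simp only [Finset.mem_filter, Finset.mem_univ, true_and] at hω
    have herr := hω
    rw [Fintype.card_fun, Fintype.card_fin, Fintype.card_bool] at herr
    -- `typedHyp` is `runHypP` at `θ = μ/2/2/(4p)`
    have hθ' : typedHyp R n a b ℓ f ω = runHypP (designP (teP_ne_zero n a b ℓ) _ ℓ (lvl_hn n a b ℓ)) (natTest R ℓ) f
        (muP n a b ℓ / 2 / 2 / (4 * 𝔭)) ω := by rw [typedHyp, H.hθ]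
    rw [hθ', errCount]
    -- `#errs ≤ 2 · (1/(4a)) · 2ⁿ` gives `2a · #errs ≤ 2ⁿ`
    have hR : (2 * a : ℝ) * ((univ.filter fun x => runHypP (designP (teP_ne_zero n a b ℓ) _ ℓ (lvl_hn n a b ℓ)) (natTest R ℓ) f
        (muP n a b ℓ / 2 / 2 / (4 * 𝔭)) ω x ≠ f x).card : ℝ) ≤ (2 : ℝ) ^ n := by
      have := mul_le_mul_of_nonneg_left herr (show (0 : ℝ) ≤ 2 * a by positivity)
      refine this.trans (le_of_eq ?_)
      push_cast
      field_simp
      norm_num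
    exact_mod_cast hR

end Typed

end Modp

end Literature.Computability.Learning
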